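import Literature.NumberTheory.Automorphic.BockleHuiIrreducibleGL3WeightProofs
import HarnessLib

/-!
# Böckle–Hui 2025, Theorem 1.2 — the contragredient input removed: the dual slots of (L-eq) in the
# `L²` model (proofs only)

Topic `NumberTheory/Automorphic`; namespace `Literature.NumberTheory.Automorphic`.  Fifth PROOFS file
(theorems only: no definition, no named fact, no `sorry`) for the named fact
`isIrreducible_galoisRep_gl3_totallyReal` (Böckle–Hui, Math. Ann. 393 (2025), Thm. 1.2, arXiv
p. 13), after `BockleHuiIrreducibleGL3Proofs`, `…ReductionProofs`, `…AnalyticProofs` and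
`…WeightProofs`.  The last assembly there (`isIrreducible_galoisRep_gl3_totallyReal_of_JS'`) needs,
besides Böckle–Hui's Thm. 1.1, Jacquet–Shalika (2.2) and the two printed inputs `hCar`, `hHui`, the
named fact `CuspidalAutomorphicRepData.exists_contragredient_satake` (the contragredient `π^∨` as a
Borel–Jacquet datum with the inverse Satake parameters at EVERY unramified place).  The printed proof
(BH §3.2.1, p. 13: "`L^{S'}(1, s) L^{S'}(Alt²(π) ⊗ ψ₁, s) = L^{S'}(π ⊗ ψ₂, s) L^{S'}(ψ₃, s)`", with
`Alt²(π) = π^∨ ⊗ ω_π` on `GL_3`) only ever uses `π^∨` through the partial `L`-functions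
`L^S(s, π^∨ × χ)` for Hecke characters `χ`, i.e. through the Satake family `t_{π,v}⁻¹` at almost all
places; and for the UNITARY normalisation `π₀ ⊗ |det|^{s} ≃ π`, `π₀ ≤ L²_cusp`
(`CuspidalAutomorphicRepData.exists_normalisation_L2`, unconditional) the contragredient is realised
by complex conjugation, `π₀^∨ = π̄₀ = P.conj` with `t_{π̄₀,v} = \bar t_{π₀,v} = t_{π₀,v}⁻¹`
(`IsSatakeFamilyOf.conj`, `IsSatakeFamilyOf.map_inv_eq_map_conj`; Arthur–Clozel, Ch. 3, p. 172).
Hence every analytic statement about `L^S(s, π^∨ × χ)` needed in §3.2.1 — convergence (Jacquet–Shalika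
I, Thm. 5.3: `JacquetShalika1981_multipliable_partialPairL_holds`), holomorphy and non-vanishing on
`Re s > 1` (`differentiableOn_partialPairL_of_isSatakeFamilyOf`, `partialPairL_ne_zero_of_isSatakeFamilyOf`)
and the finite non-zero boundary value at `s → 1` ((2.2) for `GL_3 × GL_1` in `L²`:
`JacquetShalika1981_partialPairL_at_one_of_rank_ne`, or `…_boundary_of_ne_one` when the unitary
normalisation carries an imaginary shift) — is available WITHOUT the contragredient datum
(`analyticPackage_dual`).  Re-running the (L-eq) argument of the previous two files with the two
`GL_3` slots abstracted to such "analytic packages" (`eventually_eq_one_of_eulerIdentity_of_packages`,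
`false_of_eulerIdentity_of_shift_of_packages`, `false_of_large_heckeCharacter_mem_satake'`,
`norm_prod_satake_eq_norm_cube`, `prod_satake_eq_cube`) gives:

* `isIrreducible_galoisRep_gl3_totallyReal_of_JS_L2` — **Böckle–Hui, Theorem 1.2, from Böckle–Hui
  Thm. 1.1 (`exists_heckeCharacter_of_weaklyDivides`), Jacquet–Shalika (2.2) (the Borel–Jacquet form
  `JacquetShalika1981_partialPairL_boundary_repData` and the two `L²` leaves
  `JacquetShalika1981_partialPairL_at_one_of_rank_ne`, `…_boundary_of_ne_one`), C-arithmeticity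
  (`hCar`) and [Hu23a] (`hHui`)** — no contragredient datum;
* `isIrreducible_galoisRep_gl3_totallyReal_of_L2_leaves'` — the same with (2.2) taken entirely at its
  four `L²` leaves (`…_at_one_of_ne_conj`, `…_boundary_of_ne_one`, `…_at_one_of_rank_ne`,
  `multiplicity_one_gl`).

## References

* G. Böckle, C.-Y. Hui, *Weak abelian direct summands and irreducibility of Galois
  representations*, Math. Ann. 393 (2025), §3.2.1 (arXiv:2404.08954, p. 13). [BockleHui2025]
* J. Arthur, L. Clozel, *Simple algebras, base change, and the advanced theory of the trace
  formula*, Ann. of Math. Stud. 120 (1989), Ch. 3 §2, (2.1)–(2.2), pp. 171–172. [ArthurClozelAMS120]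
* H. Jacquet, J. A. Shalika, *On Euler products and the classification of automorphic
  representations I, II*, Amer. J. Math. 103 (1981), Thm. (5.3); Prop. 3.6. [JacquetShalikaAJM1981]
* A. Borel, H. Jacquet, *Automorphic forms and automorphic representations*, PSPM 33.1 (1979),
  4.6, 5.7. [BorelJacquetCorvallis1979]
-/

noncomputable section

open scoped MatrixGroups Topology Classical NumberField
open NumberField IsDedekindDomain MeasureTheory Filter Polynomial

namespace Literature.NumberTheory.Automorphic

open AdelicGroupData
open Literature.NumberTheory.GaloisRepresentations (HeckeCharacter ideleGroup localUnits)
open Literature.NumberTheory.GaloisRepresentations.HeckeCharacter (valueAtUniformizer_mul valueAtUniformizer_inv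
  valueAtUniformizer_pow ideleNorm_pos')

/-! ### Bookkeeping

The basic `valueAtUniformizer` API (`_mul`, `_inv`, `_pow`, `heckeCharacter_valueAtUniformizer_ne_zero`)
and `HeckeCharacter.ideleNorm_pos'` are the tree's public lemmas (opened above); the former private copies
`nc_vAU_inv/_pow/_ne_zero`, `nc_ideleNorm_pos` were retired (dedup-01039…01042). -/

section Bookkeeping

variable {F : Type} [Field F] [NumberField F]

/-- `χ(ϖ_v)` is the value of `χ` at the idele `(…, 1, ϖ_v, 1, …)`. [folklore] -/
private theorem nc_vAU_apply (χ : HeckeCharacter F) (v : HeightOneSpectrum (𝓞 F)) :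
    χ.valueAtUniformizer v =
      ((χ (localUnits v (GaloisRepresentations.HeckeCharacter.uniformizer F v)) : ℂˣ) : ℂ) := by
  simp only [GaloisRepresentations.HeckeCharacter.valueAtUniformizer,
    GaloisRepresentations.HeckeCharacter.localComponent_apply]

/-- `|χ(ϖ_v)| = q_v^{-σ}` when `|χ| = ‖·‖^{σ}` on ideles. [cite: TateThesis1967, §4.3] -/
private theorem nc_norm_vAU_eq_rpow_neg {χ : HeckeCharacter F} {σ : ℝ}
    (hσ : ∀ x : ideleGroup F, ‖((χ x : ℂˣ) : ℂ)‖ = GaloisRepresentations.ideleNorm x ^ σ)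
    (v : HeightOneSpectrum (𝓞 F)) :
    ‖χ.valueAtUniformizer v‖ = (v.residueCard : ℝ) ^ (-σ) := by
  obtain ⟨lam, hlam⟩ := exists_heckeCharacter_ideleNorm_cpow F (σ : ℂ)
  have hχlam : ∀ x : ideleGroup F, ‖((χ x : ℂˣ) : ℂ)‖ = ‖((lam x : ℂˣ) : ℂ)‖ := fun x => by
    rw [hσ x, hlam x, Complex.norm_cpow_eq_rpow_re_of_pos (ideleNorm_pos' _ x), Complex.ofReal_re]
  have h1 : ‖χ.valueAtUniformizer v‖ = ‖lam.valueAtUniformizer v‖ := by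
    rw [nc_vAU_apply, nc_vAU_apply]
    exact hχlam _
  rw [h1, HeckeCharacter.valueAtUniformizer_of_cpow hlam v, norm_inv,
    Complex.norm_natCast_cpow_of_pos (Nat.zero_lt_of_lt v.one_lt_residueCard), Complex.ofReal_re,
    Real.rpow_neg (Nat.cast_nonneg _)]

/-- `‖(q_v : ℂ) ^ z‖ = q_v ^ {re z}`. [folklore] -/
private theorem nc_norm_qpow (v : HeightOneSpectrum (𝓞 F)) (z : ℂ) :
    ‖(v.residueCard : ℂ) ^ z‖ = (v.residueCard : ℝ) ^ z.re :=
  Complex.norm_natCast_cpow_of_pos (Nat.zero_lt_of_lt v.one_lt_residueCard) z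

/-- `(q_v : ℂ) ^ z ≠ 0`. [folklore] -/
private theorem nc_qpow_ne_zero (v : HeightOneSpectrum (𝓞 F)) (z : ℂ) : (v.residueCard : ℂ) ^ z ≠ 0 := by
  have hq : (v.residueCard : ℂ) ≠ 0 :=
    Nat.cast_ne_zero.2 (ne_of_gt (lt_trans zero_lt_one v.one_lt_residueCard))
  exact fun h => hq ((Complex.cpow_eq_zero_iff _ _).1 h).1

/-- From `((q : ℝ)^x)^n = 1` with `q > 1`, `n ≠ 0`: `x = 0`. [folklore] -/
private theorem nc_rpow_pow_eq_one {q n : ℕ} (hq : 1 < q) (hn : n ≠ 0) {x : ℝ}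
    (h : ((q : ℝ) ^ x) ^ n = 1) : x = 0 := by
  have hq0 : (0 : ℝ) < q := by exact_mod_cast (lt_trans zero_lt_one hq)
  have hpos : (0 : ℝ) < (q : ℝ) ^ x := Real.rpow_pos_of_pos hq0 _
  have h1q : (q : ℝ) ^ x = 1 := (pow_eq_one_iff_of_nonneg hpos.le hn).mp h
  have hq' : (1 : ℝ) < q := by exact_mod_cast hq
  rcases lt_trichotomy x 0 with hlt | heq | hgt
  · exact absurd h1q (ne_of_lt (Real.rpow_lt_one_of_one_lt_of_neg hq' hlt))
  · exact heq
  · exact absurd h1q (ne_of_gt (Real.one_lt_rpow hq' hgt))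

/-- Shifting no family: `γ w = q_w^{0} γ w`. [folklore] -/
private theorem nc_shift_zero {S : Set (HeightOneSpectrum (𝓞 F))} (γ : SatakeFamily F) :
    ∀ w ∉ S, γ w = (γ w).map (((w.residueCard : ℂ) ^ (0 : ℂ)) * ·) := fun w _ => by
  simp only [Complex.cpow_zero, one_mul, Multiset.map_id']

/-- **Folding a `GL_1`-twist into the `GL_1` slot**: the Rankin–Selberg Euler factor of
`(π ⊗ χ) × 𝟙` is that of `π × χ`, `det(1 - (c t) ⊗ 1 · T) = det(1 - t ⊗ c · T)`. [folklore] -/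
theorem satakePairPolynomial_map_mul_one (α : Multiset ℂ) (c : ℂ) :
    satakePairPolynomial (α.map (c * ·)) {1} = satakePairPolynomial α {c} := by
  simp only [satakePairPolynomial_eq_eulerPolynomial, satakeTensor_comm _ ({1} : Multiset ℂ),
    satakeTensor_comm α {c}, satakeTensor_singleton_left, Multiset.map_map, Function.comp_def,
    one_mul]

/-- A Satake family of `π` (choice of a Satake parameter at every unramified place). [folklore] -/
private theorem nc_exists_satakeFamily_of {n : ℕ} {h : isCompact_glFiniteIntegralLevel n F}
    (π : AutomorphicRepData (AutomorphyDatum.gl n F h)) :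
    ∃ f : SatakeFamily F, ∀ᶠ w : HeightOneSpectrum (𝓞 F) in cofinite, π.HasSatakeParamAt w (f w) :=
  ⟨fun w => if hw : π.IsUnramifiedAt w then hw.choose else 0, by
    filter_upwards [π.hasSatakeParamAt_cofinite_holds] with w hw
    rw [dif_pos hw]
    exact hw.choose_spec⟩

end Bookkeeping

/-! ### Analytic packages: `L^S(s, π × χ)` and `L^S(s, π^∨ × χ)` for a Borel–Jacquet datum `π`
and a unitary Hecke character `χ` -/

section Packages

variable {F : Type} [Field F] [NumberField F]

/-- **The analytic package of `L^S(s, π × χ)`** for a cuspidal Borel–Jacquet datum `π` on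
`GL_n(𝔸_F)` (`n ≥ 2`) with unitary a.e. Satake family `β` and a Hecke character `χ` unitary at almost
all places: there is a finite `S₀` such that for every finite `S ⊇ S₀` the Euler product
`L^S(s, β ⊗ {χ(ϖ)})` is multipliable on `Re s > 1` (Jacquet–Shalika I, Thm. 5.3:
`JacquetShalika1981_multipliable_partialPairL_repData_holds`), continuous and non-zero at every point of
`Re s > 1` (`continuousAt_and_ne_zero_partialPairL_repData`), and has a finite non-zero limit as
`s → 1`, `Re s > 1` ((2.2) for `GL_n × GL_1`, `n ≠ 1`, so `X = ∅`:
`JacquetShalika1981_partialPairL_boundary_repData`), the `GL_1` datum being that of `χ`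
(`exists_cuspidal_glOne_hasSatakeParamAt_valueAtUniformizer`).
[cite: ArthurClozelAMS120, Ch. 3 §2 (2.1)–(2.2)] -/
theorem analyticPackage_repData (hJ2 : JacquetShalika1981_partialPairL_boundary_repData)
    {n : ℕ} [NeZero n] (hn1 : n ≠ 1) {hF : isCompact_glFiniteIntegralLevel n F}
    (P : CuspidalAutomorphicRepData n F hF) (β : SatakeFamily F)
    (hP : ∀ᶠ w : HeightOneSpectrum (𝓞 F) in cofinite, P.1.HasSatakeParamAt w (β w))
    (huβ : ∀ᶠ w : HeightOneSpectrum (𝓞 F) in cofinite, ‖(β w).prod‖ = 1)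
    (χ : HeckeCharacter F)
    (huχ : ∀ᶠ w : HeightOneSpectrum (𝓞 F) in cofinite, ‖χ.valueAtUniformizer w‖ = 1) :
    ∃ S₀ : Set (HeightOneSpectrum (𝓞 F)), S₀.Finite ∧
      ∀ {S : Set (HeightOneSpectrum (𝓞 F))} (_hS : S.Finite) (_hS₀ : S₀ ⊆ S),
        (∀ s : ℂ, 1 < s.re → Multipliable fun v : {v : HeightOneSpectrum (𝓞 F) // v ∉ S} =>
          ((satakePairPolynomial (β v.1) {χ.valueAtUniformizer v.1}).eval
            ((v.1.residueCard : ℂ) ^ (-s)))⁻¹) ∧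
        (∀ s : ℂ, 1 < s.re →
          ContinuousAt (partialPairL S β (fun w => {χ.valueAtUniformizer w})) s ∧
            partialPairL S β (fun w => {χ.valueAtUniformizer w}) s ≠ 0) ∧
        (∃ c : ℂ, c ≠ 0 ∧ Tendsto (partialPairL S β (fun w => {χ.valueAtUniformizer w}))
          (𝓝[{s : ℂ | 1 < s.re}] 1) (𝓝 c)) := by
  have h1 : isCompact_glFiniteIntegralLevel 1 F := isCompact_glFiniteIntegralLevel_holds 1 F
  obtain ⟨τ, hτ⟩ := exists_cuspidal_glOne_hasSatakeParamAt_valueAtUniformizer h1 χ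
  obtain ⟨S₁, hS₁, hJ1a⟩ := JacquetShalika1981_multipliable_partialPairL_repData_holds n 1 F hF h1
    (NeZero.pos n) one_pos P τ
  obtain ⟨S₂, hS₂, hIa⟩ := continuousAt_and_ne_zero_partialPairL_repData P τ
  obtain ⟨S₃, hS₃, hJ2a⟩ := hJ2 n 1 F hF h1 (NeZero.pos n) one_pos P τ
  have hgood : ∀ᶠ w : HeightOneSpectrum (𝓞 F) in cofinite, P.1.HasSatakeParamAt w (β w) ∧
      ‖(β w).prod‖ = 1 ∧ ‖χ.valueAtUniformizer w‖ = 1 ∧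
      τ.1.HasSatakeParamAt w {χ.valueAtUniformizer w} := by
    filter_upwards [hP, huβ, huχ, hτ] with w h₁ h₂ h₃ h₄
    exact ⟨h₁, h₂, h₃, h₄⟩
  obtain ⟨E, hE, hgoodE⟩ : ∃ E : Set (HeightOneSpectrum (𝓞 F)), E.Finite ∧ ∀ w ∉ E,
      P.1.HasSatakeParamAt w (β w) ∧ ‖(β w).prod‖ = 1 ∧ ‖χ.valueAtUniformizer w‖ = 1 ∧
      τ.1.HasSatakeParamAt w {χ.valueAtUniformizer w} :=
    ⟨_, Filter.eventually_cofinite.1 hgood, fun w hw => not_not.1 hw⟩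
  refine ⟨S₁ ∪ S₂ ∪ S₃ ∪ E, ((hS₁.union hS₂).union hS₃).union hE, ?_⟩
  intro S hS hS₀
  have sub₁ : S₁ ⊆ S := fun x hx => hS₀ (by simp [hx])
  have sub₂ : S₂ ⊆ S := fun x hx => hS₀ (by simp [hx])
  have sub₃ : S₃ ⊆ S := fun x hx => hS₀ (by simp [hx])
  have subE : E ⊆ S := fun x hx => hS₀ (by simp [hx])
  have hES : ∀ w ∉ S, w ∉ E := fun w hw h => hw (subE h)
  have hPS : ∀ w ∉ S, P.1.HasSatakeParamAt w (β w) := fun w hw => (hgoodE w (hES w hw)).1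
  have huβS : ∀ w ∉ S, ‖(β w).prod‖ = 1 := fun w hw => (hgoodE w (hES w hw)).2.1
  have hτS : ∀ w ∉ S, τ.1.HasSatakeParamAt w
      ((fun w => ({χ.valueAtUniformizer w} : Multiset ℂ)) w) :=
    fun w hw => (hgoodE w (hES w hw)).2.2.2
  have huχS : ∀ w ∉ S, ‖((fun w => ({χ.valueAtUniformizer w} : Multiset ℂ)) w).prod‖ = 1 :=
    fun w hw => by
    show ‖({χ.valueAtUniformizer w} : Multiset ℂ).prod‖ = 1
    rw [Multiset.prod_singleton]
    exact (hgoodE w (hES w hw)).2.2.1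
  refine ⟨fun s hs => hJ1a hS sub₁ hPS hτS huβS huχS hs,
    fun s hs => hIa hS sub₂ hPS hτS huβS huχS hs, ?_⟩
  obtain ⟨c, hc, h⟩ := hJ2a hS sub₃ hPS hτS huβS huχS Complex.one_re (fun h => hn1 h.1)
  exact ⟨c, hc, h⟩

/-- **The analytic package of `L^S(s, π^∨ × χ)` WITHOUT a contragredient datum.**  For a cuspidal
Borel–Jacquet datum `π` on `GL_n(𝔸_F)` (`n ≥ 2`) with unitary a.e. Satake family `β` and a Hecke
character `χ` unitary a.e., there is a finite `S₀` such that for every finite `S ⊇ S₀` the Euler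
product `L^S(s, β⁻¹ ⊗ {χ(ϖ)})` of the INVERSE family is multipliable on `Re s > 1`, continuous and
non-zero there, and has a finite non-zero limit as `s → 1`, `Re s > 1`.  Proof: take the unitary
normalisations `β = q^{a} α_P` (`P ≤ L²_cusp`, `CuspidalAutomorphicRepData.exists_normalisation_L2`) and
`{χ(ϖ)} = q^{k} e` (`E ≤ L²_cusp(GL_1)`), `Re a = Re k = 0` by unitarity; then
`β⁻¹ = q^{-a} \bar α_P` is, up to the shift, the Satake family of the CONJUGATE `P̄ = P.conj`
(`IsSatakeFamilyOf.conj`, `IsSatakeFamilyOf.map_inv_eq_map_conj`: `t_{π̃} = \bar t_π` for unitary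
cuspidal `π`, Arthur–Clozel p. 172), so `L^S(s, β⁻¹ ⊗ {χ}) = L^S(s + a - k, P̄ × E)`
(`partialPairL_eq_of_shift`), to which Jacquet–Shalika I, Thm. 5.3 in `L²`
(`JacquetShalika1981_multipliable_partialPairL_holds`, `differentiableOn_partialPairL_of_isSatakeFamilyOf`,
`partialPairL_ne_zero_of_isSatakeFamilyOf`) and (2.2) in `L²` at `s₀ = 1 + a - k` (`Re s₀ = 1`;
`JacquetShalika1981_partialPairL_at_one_of_rank_ne` if `s₀ = 1`, `…_boundary_of_ne_one` otherwise)
apply. [cite: ArthurClozelAMS120, Ch. 3 §2 (2.1)–(2.2) and p. 172] -/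
theorem analyticPackage_dual
    (hrk : ∀ {n m : ℕ} {K : Type} [Field K] [NumberField K]
      {μ : Measure (gl n K).automorphicQuotient} [(gl n K).IsAutomorphicMeasure μ]
      {μ' : Measure (gl m K).automorphicQuotient} [(gl m K).IsAutomorphicMeasure μ'],
      JacquetShalika1981_partialPairL_at_one_of_rank_ne (n := n) (m := m) (K := K) (μ := μ)
        (μ' := μ'))
    (h22' : ∀ {n m : ℕ} {K : Type} [Field K] [NumberField K]
      {μ : Measure (gl n K).automorphicQuotient} [(gl n K).IsAutomorphicMeasure μ]
      {μ' : Measure (gl m K).automorphicQuotient} [(gl m K).IsAutomorphicMeasure μ'],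
      JacquetShalika1981_partialPairL_boundary_of_ne_one (n := n) (m := m) (K := K) (μ := μ)
        (μ' := μ'))
    {n : ℕ} [NeZero n] (hn1 : n ≠ 1) {hF : isCompact_glFiniteIntegralLevel n F}
    (P : CuspidalAutomorphicRepData n F hF) (β : SatakeFamily F)
    (hP : ∀ᶠ w : HeightOneSpectrum (𝓞 F) in cofinite, P.1.HasSatakeParamAt w (β w))
    (huβ : ∀ᶠ w : HeightOneSpectrum (𝓞 F) in cofinite, ‖(β w).prod‖ = 1)
    (χ : HeckeCharacter F)
    (huχ : ∀ᶠ w : HeightOneSpectrum (𝓞 F) in cofinite, ‖χ.valueAtUniformizer w‖ = 1) :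
    ∃ S₀ : Set (HeightOneSpectrum (𝓞 F)), S₀.Finite ∧
      ∀ {S : Set (HeightOneSpectrum (𝓞 F))} (_hS : S.Finite) (_hS₀ : S₀ ⊆ S),
        (∀ s : ℂ, 1 < s.re → Multipliable fun v : {v : HeightOneSpectrum (𝓞 F) // v ∉ S} =>
          ((satakePairPolynomial ((β v.1).map (·⁻¹)) {χ.valueAtUniformizer v.1}).eval
            ((v.1.residueCard : ℂ) ^ (-s)))⁻¹) ∧
        (∀ s : ℂ, 1 < s.re →
          ContinuousAt (partialPairL S (fun w => (β w).map (·⁻¹)) (fun w => {χ.valueAtUniformizer w}))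
              s ∧
            partialPairL S (fun w => (β w).map (·⁻¹)) (fun w => {χ.valueAtUniformizer w}) s ≠ 0) ∧
        (∃ c : ℂ, c ≠ 0 ∧
          Tendsto (partialPairL S (fun w => (β w).map (·⁻¹)) (fun w => {χ.valueAtUniformizer w}))
            (𝓝[{s : ℂ | 1 < s.re}] 1) (𝓝 c)) := by
  have h1 : isCompact_glFiniteIntegralLevel 1 F := isCompact_glFiniteIntegralLevel_holds 1 F
  obtain ⟨μn, hμn⟩ := AdelicGroupData.exists_isAutomorphicMeasure_gl_holds n F
  obtain ⟨μ1, hμ1⟩ := AdelicGroupData.exists_isAutomorphicMeasure_gl_holds 1 F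
  haveI := hμn
  haveI := hμ1
  obtain ⟨τ, hτ⟩ := exists_cuspidal_glOne_hasSatakeParamAt_valueAtUniformizer h1 χ
  obtain ⟨a, P₀, SA, A, hSA, hA, hiffA⟩ := CuspidalAutomorphicRepData.exists_normalisation_L2 hF μn P
  obtain ⟨k, E₀, Se, e, hSe, he, hiffe⟩ := CuspidalAutomorphicRepData.exists_normalisation_L2 h1 μ1 τ
  have hgood : ∀ᶠ w : HeightOneSpectrum (𝓞 F) in cofinite, P.1.HasSatakeParamAt w (β w) ∧
      ‖(β w).prod‖ = 1 ∧ ‖χ.valueAtUniformizer w‖ = 1 ∧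
      τ.1.HasSatakeParamAt w {χ.valueAtUniformizer w} := by
    filter_upwards [hP, huβ, huχ, hτ] with w h₁ h₂ h₃ h₄
    exact ⟨h₁, h₂, h₃, h₄⟩
  obtain ⟨E, hE, hgoodE⟩ : ∃ E : Set (HeightOneSpectrum (𝓞 F)), E.Finite ∧ ∀ w ∉ E,
      P.1.HasSatakeParamAt w (β w) ∧ ‖(β w).prod‖ = 1 ∧ ‖χ.valueAtUniformizer w‖ = 1 ∧
      τ.1.HasSatakeParamAt w {χ.valueAtUniformizer w} :=
    ⟨_, Filter.eventually_cofinite.1 hgood, fun w hw => not_not.1 hw⟩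
  refine ⟨SA ∪ Se ∪ E, (hSA.union hSe).union hE, ?_⟩
  intro S hS hS₀
  have subA : SA ⊆ S := fun x hx => hS₀ (by simp [hx])
  have sube : Se ⊆ S := fun x hx => hS₀ (by simp [hx])
  have subE : E ⊆ S := fun x hx => hS₀ (by simp [hx])
  have hES : ∀ w ∉ S, w ∉ E := fun w hw h => hw (subE h)
  have hPS : ∀ w ∉ S, P.1.HasSatakeParamAt w (β w) := fun w hw => (hgoodE w (hES w hw)).1
  have huβS : ∀ w ∉ S, ‖(β w).prod‖ = 1 := fun w hw => (hgoodE w (hES w hw)).2.1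
  have huχS : ∀ w ∉ S, ‖χ.valueAtUniformizer w‖ = 1 := fun w hw => (hgoodE w (hES w hw)).2.2.1
  have hτS : ∀ w ∉ S, τ.1.HasSatakeParamAt w {χ.valueAtUniformizer w} :=
    fun w hw => (hgoodE w (hES w hw)).2.2.2
  have hA' : IsSatakeFamilyOf P₀ S A := hA.mono subA
  have hAc : IsSatakeFamilyOf P₀.conj S (fun w => (A w).map (starRingEnd ℂ)) := hA'.conj
  have he' : IsSatakeFamilyOf E₀ S e := he.mono sube
  have hβw : ∀ w ∉ S, β w = (A w).map (((w.residueCard : ℂ) ^ a) * ·) := fun w hw =>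
    (hiffA w (fun h => hw (subA h)) (β w)).1 (hPS w hw)
  -- the two families of the statement, as translates of `L²` families
  have hχw : ∀ w ∉ S, (fun w => ({χ.valueAtUniformizer w} : Multiset ℂ)) w =
      (e w).map (((w.residueCard : ℂ) ^ k) * ·) := fun w hw =>
    (hiffe w (fun h => hw (sube h)) {χ.valueAtUniformizer w}).1 (hτS w hw)
  -- the inverse family is the conjugate family shifted by `-a`
  have hinv : ∀ w ∉ S, (fun w => (β w).map (·⁻¹)) w =
      ((fun w => (A w).map (starRingEnd ℂ)) w).map (((w.residueCard : ℂ) ^ (-a)) * ·) := by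
    intro w hw
    show (β w).map (·⁻¹) = ((A w).map (starRingEnd ℂ)).map (((w.residueCard : ℂ) ^ (-a)) * ·)
    rw [← hA'.map_inv_eq_map_conj hw, hβw w hw, Multiset.map_map, Multiset.map_map]
    refine Multiset.map_congr rfl fun x _ => ?_
    show ((w.residueCard : ℂ) ^ a * x)⁻¹ = (w.residueCard : ℂ) ^ (-a) * x⁻¹
    rw [mul_inv, Complex.cpow_neg]
  have eF := pairEulerFactor_eq_of_shift hinv hχw
  have pF := partialPairL_eq_of_shift hinv hχw
  by_cases hex : ∃ w, w ∉ S
  · obtain ⟨w₀, hw₀⟩ := hex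
    -- unitarity of the shifts
    have ha : a.re = 0 := by
      obtain ⟨𝔫, -, -, ϖ, hSat⟩ := hA' w₀ hw₀
      have h := huβS w₀ hw₀
      rw [hβw w₀ hw₀, prod_map_const_mul_eq, hSat.card_eq, norm_mul, norm_pow, hSat.norm_prod_eq_one,
        mul_one, nc_norm_qpow] at h
      exact nc_rpow_pow_eq_one w₀.one_lt_residueCard (NeZero.ne n) h
    have hk : k.re = 0 := by
      obtain ⟨𝔫, -, -, ϖ, hSat⟩ := he' w₀ hw₀
      have h := huχS w₀ hw₀
      have hp := congrArg Multiset.prod (hχw w₀ hw₀)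
      rw [show ((fun w => ({χ.valueAtUniformizer w} : Multiset ℂ)) w₀).prod = χ.valueAtUniformizer w₀
          from Multiset.prod_singleton _, prod_map_const_mul_eq, hSat.card_eq] at hp
      rw [hp, norm_mul, norm_pow, hSat.norm_prod_eq_one, mul_one, nc_norm_qpow] at h
      exact nc_rpow_pow_eq_one w₀.one_lt_residueCard one_ne_zero h
    have hre : ∀ s : ℂ, (s - (-a + k)).re = s.re := fun s => by
      simp only [Complex.sub_re, Complex.add_re, Complex.neg_re, ha, hk, neg_zero, add_zero, sub_zero]
    have hopen : IsOpen {s : ℂ | 1 < s.re} := isOpen_lt continuous_const Complex.continuous_re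
    have hD := differentiableOn_partialPairL_of_isSatakeFamilyOf P₀.conj E₀ hAc he'
    refine ⟨fun s hs => ?_, fun s hs => ⟨?_, ?_⟩, ?_⟩
    · exact (JacquetShalika1981_multipliable_partialPairL_holds P₀.conj E₀ hAc he'
        (show 1 < (s - (-a + k)).re by rw [hre]; exact hs)).congr fun v => (congrFun (eF s) v).symm
    · rw [pF]
      have hs' : 1 < (s - (-a + k)).re := by rw [hre]; exact hs
      have hf : ContinuousAt (fun z : ℂ => z - (-a + k)) s :=
        (continuous_id.sub continuous_const).continuousAt
      exact ContinuousAt.comp (g := partialPairL S (fun w => (A w).map (starRingEnd ℂ)) e)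
        (hD.differentiableAt (hopen.mem_nhds hs')).continuousAt hf
    · rw [pF]
      exact partialPairL_ne_zero_of_isSatakeFamilyOf P₀.conj E₀ hAc he' (by rw [hre]; exact hs)
    · -- the boundary value at `s₀ = 1 + a - k`, `Re s₀ = 1`
      have hs₀ : (1 - (-a + k) : ℂ).re = 1 := by rw [hre, Complex.one_re]
      have hlim : ∃ c : ℂ, c ≠ 0 ∧ Tendsto (partialPairL S (fun w => (A w).map (starRingEnd ℂ)) e)
          (𝓝[{s : ℂ | 1 < s.re}] (1 - (-a + k))) (𝓝 c) := by
        by_cases hs1 : (1 - (-a + k) : ℂ) = 1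
        · rw [hs1]
          exact hrk hn1 (NeZero.pos n) one_pos P₀.conj E₀ hS hAc he'
        · exact h22' (NeZero.pos n) one_pos P₀.conj E₀ hS hAc he' hs₀ hs1
      obtain ⟨c, hc, hcT⟩ := hlim
      refine ⟨c, hc, ?_⟩
      rw [pF]
      have hmap : Tendsto (fun s : ℂ => s - (-a + k)) (𝓝[{s : ℂ | 1 < s.re}] 1)
          (𝓝[{s : ℂ | 1 < s.re}] (1 - (-a + k))) := by
        refine tendsto_nhdsWithin_of_tendsto_nhds_of_eventually_within _ ?_ ?_
        · exact ((continuous_id.sub continuous_const).tendsto 1).mono_left nhdsWithin_le_nhds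
        · refine eventually_nhdsWithin_of_forall fun s hs => ?_
          show 1 < (s - (-a + k)).re
          rw [hre]
          exact hs
      exact hcT.comp hmap
  · -- no finite place outside `S`: the Euler products are empty
    haveI hE' : IsEmpty {v : HeightOneSpectrum (𝓞 F) // v ∉ S} := ⟨fun v => hex ⟨v.1, v.2⟩⟩
    have hconst : partialPairL S (fun w => (β w).map (·⁻¹)) (fun w => {χ.valueAtUniformizer w}) =
        fun _ => 1 := by
      funext z
      unfold partialPairL
      exact tprod_empty
    refine ⟨fun s _ => multipliable_empty, fun s _ => ?_, ⟨1, one_ne_zero, ?_⟩⟩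
    · rw [hconst]
      exact ⟨continuousAt_const, one_ne_zero⟩
    · rw [hconst]
      exact tendsto_const_nhds

end Packages

/-! ### The two (L-eq) arguments with abstract `GL_3` slots -/

section Abstract

variable {F : Type} [Field F] [NumberField F]

/-- **The analytic core of BH §3.2.1 on the unitary axis, with abstract `GL_3` slots.**  Let `τ₀`,
`τν` be cuspidal data on `GL(1)` with Satake families `{1}`, `tν` (unitary) off a finite `T`, and let
`(β, t₁)` and `(γ, δ)` be two pairs of Satake families whose partial Rankin–Selberg `L`-functions off
every finite `S ⊇ T` are multipliable on `Re s > 1`, the first with a finite limit and the second with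
a finite NON-ZERO limit as `s → 1`, `Re s > 1` (the analytic packages of `L^S(s, π₀ × θ⁻¹)` and of
`L^S(s, π₀^∨ ⊗ κ) = L^S(s, π₀^∨ × κ)`).  If the Euler factors satisfy
`P(β, t₁) P(tν, 1) = P(1, 1) P(γ, δ)` off `T`, then `tν_w = {1}` for almost all `w` — as in
`eventually_eq_one_of_JS_of_eulerIdentity` (Jacquet–Shalika (2.2) for the `GL_1 × GL_1` pair, Hecke's
pole of `ζ_F^S`, `false_of_pole_times_nonzero_eq_finite`). [cite: BockleHui2025, §3.2.1]
[cite: ArthurClozelAMS120, Ch. 3 §2 (2.1)–(2.2)] -/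
theorem eventually_eq_one_of_eulerIdentity_of_packages
    (hJ2 : JacquetShalika1981_partialPairL_boundary_repData)
    {h1 : isCompact_glFiniteIntegralLevel 1 F}
    (τ₀ τν : CuspidalAutomorphicRepData 1 F h1)
    (one t₁ tν β γ δ : SatakeFamily F) {T : Set (HeightOneSpectrum (𝓞 F))} (hT : T.Finite)
    (hone : ∀ w, one w = {1})
    (hτ₀ : ∀ w ∉ T, τ₀.1.HasSatakeParamAt w (one w))
    (hτν : ∀ w ∉ T, τν.1.HasSatakeParamAt w (tν w)) (huν : ∀ w ∉ T, ‖(tν w).prod‖ = 1)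
    (hmP : ∀ {S : Set (HeightOneSpectrum (𝓞 F))}, S.Finite → T ⊆ S → ∀ s : ℂ, 1 < s.re →
      Multipliable fun v : {v : HeightOneSpectrum (𝓞 F) // v ∉ S} =>
        ((satakePairPolynomial (β v.1) (t₁ v.1)).eval ((v.1.residueCard : ℂ) ^ (-s)))⁻¹)
    (hbP : ∀ {S : Set (HeightOneSpectrum (𝓞 F))}, S.Finite → T ⊆ S →
      ∃ c : ℂ, Tendsto (partialPairL S β t₁) (𝓝[{s : ℂ | 1 < s.re}] 1) (𝓝 c))
    (hmQ : ∀ {S : Set (HeightOneSpectrum (𝓞 F))}, S.Finite → T ⊆ S → ∀ s : ℂ, 1 < s.re →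
      Multipliable fun v : {v : HeightOneSpectrum (𝓞 F) // v ∉ S} =>
        ((satakePairPolynomial (γ v.1) (δ v.1)).eval ((v.1.residueCard : ℂ) ^ (-s)))⁻¹)
    (hbQ : ∀ {S : Set (HeightOneSpectrum (𝓞 F))}, S.Finite → T ⊆ S →
      ∃ c : ℂ, c ≠ 0 ∧ Tendsto (partialPairL S γ δ) (𝓝[{s : ℂ | 1 < s.re}] 1) (𝓝 c))
    (hId : ∀ w ∉ T, satakePairPolynomial (β w) (t₁ w) * satakePairPolynomial (tν w) (one w) =
      satakePairPolynomial (one w) (one w) * satakePairPolynomial (γ w) (δ w)) :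
    ∀ᶠ w : HeightOneSpectrum (𝓞 F) in cofinite,
      (tν w).map ((((w.residueCard : ℂ)) ^ ((1 : ℂ) - 1)) * ·) = (one w).map (·⁻¹) := by
  by_contra hX
  have hJ1 := JacquetShalika1981_multipliable_partialPairL_repData_holds
  obtain ⟨S₂, hS₂, hJ1b⟩ := hJ1 1 1 F h1 h1 one_pos one_pos τν τ₀
  obtain ⟨S₃, hS₃, hJ1c⟩ := hJ1 1 1 F h1 h1 one_pos one_pos τ₀ τ₀
  obtain ⟨S₆, hS₆, hJ2b⟩ := hJ2 1 1 F h1 h1 one_pos one_pos τν τ₀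
  set S : Set (HeightOneSpectrum (𝓞 F)) := T ∪ S₂ ∪ S₃ ∪ S₆ with hS_def
  have hS : S.Finite := ((hT.union hS₂).union hS₃).union hS₆
  have hTS' : T ⊆ S := fun x hx => by simp [hS_def, hx]
  have hTS : ∀ w ∉ S, w ∉ T := fun w hw hwT => hw (hTS' hwT)
  have sub₂ : S₂ ⊆ S := fun x hx => by simp [hS_def, hx]
  have sub₃ : S₃ ⊆ S := fun x hx => by simp [hS_def, hx]
  have sub₆ : S₆ ⊆ S := fun x hx => by simp [hS_def, hx]
  have hτ₀S : ∀ w ∉ S, τ₀.1.HasSatakeParamAt w (one w) := fun w hw => hτ₀ w (hTS w hw)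
  have hτνS : ∀ w ∉ S, τν.1.HasSatakeParamAt w (tν w) := fun w hw => hτν w (hTS w hw)
  have huone : ∀ w ∉ S, ‖(one w).prod‖ = 1 := fun w _ => by rw [hone]; simp
  have huνS : ∀ w ∉ S, ‖(tν w).prod‖ = 1 := fun w hw => huν w (hTS w hw)
  -- (2.1)
  have mP1 : ∀ s : ℂ, 1 < s.re → Multipliable fun v : {v : HeightOneSpectrum (𝓞 F) // v ∉ S} =>
      ((satakePairPolynomial (β v.1) (t₁ v.1)).eval ((v.1.residueCard : ℂ) ^ (-s)))⁻¹ :=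
    fun s hs => hmP hS hTS' s hs
  have mν1 : ∀ s : ℂ, 1 < s.re → Multipliable fun v : {v : HeightOneSpectrum (𝓞 F) // v ∉ S} =>
      ((satakePairPolynomial (tν v.1) (one v.1)).eval ((v.1.residueCard : ℂ) ^ (-s)))⁻¹ :=
    fun s hs => hJ1b hS sub₂ hτνS hτ₀S huνS huone hs
  have m11 : ∀ s : ℂ, 1 < s.re → Multipliable fun v : {v : HeightOneSpectrum (𝓞 F) // v ∉ S} =>
      ((satakePairPolynomial (one v.1) (one v.1)).eval ((v.1.residueCard : ℂ) ^ (-s)))⁻¹ :=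
    fun s hs => hJ1c hS sub₃ hτ₀S hτ₀S huone huone hs
  have mQ1 : ∀ s : ℂ, 1 < s.re → Multipliable fun v : {v : HeightOneSpectrum (𝓞 F) // v ∉ S} =>
      ((satakePairPolynomial (γ v.1) (δ v.1)).eval ((v.1.residueCard : ℂ) ^ (-s)))⁻¹ :=
    fun s hs => hmQ hS hTS' s hs
  -- the `GL_3` slots
  obtain ⟨c₁, hF₁⟩ := hbP hS hTS'
  obtain ⟨c₂, hc₂, hF₂⟩ := hbQ hS hTS'
  -- (2.2) for `(τν, τ₀)` outside `X`: `L^S(s, τν) → c₃`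
  obtain ⟨c₃, -, hLν⟩ := hJ2b hS sub₆ hτνS hτ₀S huνS huone Complex.one_re (fun h => hX h.2)
  -- Hecke: `(s - 1) ζ_F^S(s) → c₀ ≠ 0`
  obtain ⟨c₀, hc₀, hZ⟩ := tendsto_sub_one_mul_partialPairL_one_one hS hone
  refine false_of_pole_times_nonzero_eq_finite (l := 𝓝[{s : ℂ | 1 < s.re}] 1)
    tendsto_sub_one_nhdsWithin_one_lt_re ?_ hF₁ hLν hZ hc₀ hF₂ hc₂
  refine eventually_nhdsWithin_of_forall fun s hs => ?_
  exact partialPairL_mul_eq_of_satakePairPolynomial_mul_eq (fun v hv => hId v (hTS v hv))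
    (mP1 s hs) (mν1 s hs) (m11 s hs) (mQ1 s hs)

/-- **(L-eq) off the unitary axis, with abstract `GL_3` slots.**  As
`false_of_JS_of_eulerIdentity_of_shift`, with the two `GL_3` pairs `(β, u₁)` and `(γ, δ₁)` given by
analytic packages (multipliability on `Re s > 1` off every finite `S ⊇ T`; continuity, and for the
second pair non-vanishing, at the points of `Re s > 1`) instead of Borel–Jacquet data, and the twist
of the second pair carried by its `GL_1` slot: if `t > 0` and
`P(β, q^{-t} u₁) P(q^{-3t} uν, 1) = P(1, 1) P(γ, q^{-2t} δ₁)` off `T`, then `False`.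
[cite: BockleHui2025, §3.2.1] [cite: JacquetShalikaAJM1981, Thm. (5.3)] -/
theorem false_of_eulerIdentity_of_shift_of_packages
    {h1 : isCompact_glFiniteIntegralLevel 1 F}
    (τ₀ τν : CuspidalAutomorphicRepData 1 F h1)
    (one u₁ uν β γ δ₁ : SatakeFamily F) {T : Set (HeightOneSpectrum (𝓞 F))} (hT : T.Finite)
    (hone : ∀ w, one w = {1})
    (hτ₀ : ∀ w ∉ T, τ₀.1.HasSatakeParamAt w (one w))
    (hτν : ∀ w ∉ T, τν.1.HasSatakeParamAt w (uν w)) (huν : ∀ w ∉ T, ‖(uν w).prod‖ = 1)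
    (hmP : ∀ {S : Set (HeightOneSpectrum (𝓞 F))}, S.Finite → T ⊆ S → ∀ s : ℂ, 1 < s.re →
      Multipliable fun v : {v : HeightOneSpectrum (𝓞 F) // v ∉ S} =>
        ((satakePairPolynomial (β v.1) (u₁ v.1)).eval ((v.1.residueCard : ℂ) ^ (-s)))⁻¹)
    (hcP : ∀ {S : Set (HeightOneSpectrum (𝓞 F))}, S.Finite → T ⊆ S → ∀ s : ℂ, 1 < s.re →
      ContinuousAt (partialPairL S β u₁) s)
    (hmQ : ∀ {S : Set (HeightOneSpectrum (𝓞 F))}, S.Finite → T ⊆ S → ∀ s : ℂ, 1 < s.re →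
      Multipliable fun v : {v : HeightOneSpectrum (𝓞 F) // v ∉ S} =>
        ((satakePairPolynomial (γ v.1) (δ₁ v.1)).eval ((v.1.residueCard : ℂ) ^ (-s)))⁻¹)
    (hcQ : ∀ {S : Set (HeightOneSpectrum (𝓞 F))}, S.Finite → T ⊆ S → ∀ s : ℂ, 1 < s.re →
      ContinuousAt (partialPairL S γ δ₁) s ∧ partialPairL S γ δ₁ s ≠ 0)
    {t : ℝ} (ht : 0 < t)
    (hId : ∀ w ∉ T,
      satakePairPolynomial (β w) ((u₁ w).map (((w.residueCard : ℂ) ^ (((-t : ℝ)) : ℂ)) * ·)) *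
          satakePairPolynomial ((uν w).map (((w.residueCard : ℂ) ^ (((-(3 * t) : ℝ)) : ℂ)) * ·))
            (one w) =
        satakePairPolynomial (one w) (one w) *
          satakePairPolynomial (γ w) ((δ₁ w).map (((w.residueCard : ℂ) ^ (((-(2 * t) : ℝ)) : ℂ)) * ·))) :
    False := by
  -- the exceptional sets of the `GL_1` inputs
  obtain ⟨S₂, hS₂, hJ1b⟩ :=
    JacquetShalika1981_multipliable_partialPairL_repData_holds 1 1 F h1 h1 one_pos one_pos τν τ₀
  obtain ⟨S₃, hS₃, hJ1c⟩ :=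
    JacquetShalika1981_multipliable_partialPairL_repData_holds 1 1 F h1 h1 one_pos one_pos τ₀ τ₀
  obtain ⟨S₆, hS₆, hIb⟩ := continuousAt_and_ne_zero_partialPairL_repData τν τ₀
  set S : Set (HeightOneSpectrum (𝓞 F)) := T ∪ S₂ ∪ S₃ ∪ S₆ with hS_def
  have hS : S.Finite := ((hT.union hS₂).union hS₃).union hS₆
  have hTS' : T ⊆ S := fun x hx => by simp [hS_def, hx]
  have hTS : ∀ w ∉ S, w ∉ T := fun w hw hwT => hw (hTS' hwT)
  have sub₂ : S₂ ⊆ S := fun x hx => by simp [hS_def, hx]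
  have sub₃ : S₃ ⊆ S := fun x hx => by simp [hS_def, hx]
  have sub₆ : S₆ ⊆ S := fun x hx => by simp [hS_def, hx]
  have hτ₀S : ∀ w ∉ S, τ₀.1.HasSatakeParamAt w (one w) := fun w hw => hτ₀ w (hTS w hw)
  have hτνS : ∀ w ∉ S, τν.1.HasSatakeParamAt w (uν w) := fun w hw => hτν w (hTS w hw)
  have huone : ∀ w ∉ S, ‖(one w).prod‖ = 1 := fun w _ => by rw [hone]; simp
  have huνS : ∀ w ∉ S, ‖(uν w).prod‖ = 1 := fun w hw => huν w (hTS w hw)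
  -- the shifted families
  set su₁ : SatakeFamily F := fun w => (u₁ w).map (((w.residueCard : ℂ) ^ (((-t : ℝ)) : ℂ)) * ·)
    with hsu₁_def
  set suν : SatakeFamily F :=
    fun w => (uν w).map (((w.residueCard : ℂ) ^ (((-(3 * t) : ℝ)) : ℂ)) * ·) with hsuν_def
  set sδ : SatakeFamily F :=
    fun w => (δ₁ w).map (((w.residueCard : ℂ) ^ (((-(2 * t) : ℝ)) : ℂ)) * ·) with hsδ_def
  have hsu₁ : ∀ w ∉ S, su₁ w = (u₁ w).map (((w.residueCard : ℂ) ^ (((-t : ℝ)) : ℂ)) * ·) :=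
    fun w _ => rfl
  have hsuν : ∀ w ∉ S, suν w = (uν w).map (((w.residueCard : ℂ) ^ (((-(3 * t) : ℝ)) : ℂ)) * ·) :=
    fun w _ => rfl
  have hsδ : ∀ w ∉ S, sδ w = (δ₁ w).map (((w.residueCard : ℂ) ^ (((-(2 * t) : ℝ)) : ℂ)) * ·) :=
    fun w _ => rfl
  have eF₁ := pairEulerFactor_eq_of_shift (nc_shift_zero (S := S) β) hsu₁
  have eLν := pairEulerFactor_eq_of_shift hsuν (nc_shift_zero (S := S) one)
  have eF₂ := pairEulerFactor_eq_of_shift (nc_shift_zero (S := S) γ) hsδ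
  have pF₁ := partialPairL_eq_of_shift (nc_shift_zero (S := S) β) hsu₁
  have pLν := partialPairL_eq_of_shift hsuν (nc_shift_zero (S := S) one)
  have pF₂ := partialPairL_eq_of_shift (nc_shift_zero (S := S) γ) hsδ
  have re₁ : ∀ s : ℂ, (s - (0 + (((-t : ℝ)) : ℂ))).re = s.re + t := fun s => by
    simp only [Complex.sub_re, Complex.add_re, Complex.zero_re, Complex.ofReal_re]; ring
  have reν : ∀ s : ℂ, (s - ((((-(3 * t) : ℝ)) : ℂ) + 0)).re = s.re + 3 * t := fun s => by
    simp only [Complex.sub_re, Complex.add_re, Complex.zero_re, Complex.ofReal_re]; ring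
  have re₂ : ∀ s : ℂ, (s - (0 + (((-(2 * t) : ℝ)) : ℂ))).re = s.re + 2 * t := fun s => by
    simp only [Complex.sub_re, Complex.add_re, Complex.zero_re, Complex.ofReal_re]; ring
  -- multipliability of the four Euler products on `Re s > 1`
  have mF₁ : ∀ s : ℂ, 1 < s.re → Multipliable fun v : {v : HeightOneSpectrum (𝓞 F) // v ∉ S} =>
      ((satakePairPolynomial (β v.1) (su₁ v.1)).eval ((v.1.residueCard : ℂ) ^ (-s)))⁻¹ := by
    intro s hs
    rw [eF₁ s]
    exact hmP hS hTS' (s - (0 + (((-t : ℝ)) : ℂ))) (by rw [re₁]; linarith)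
  have mLν : ∀ s : ℂ, 1 < s.re → Multipliable fun v : {v : HeightOneSpectrum (𝓞 F) // v ∉ S} =>
      ((satakePairPolynomial (suν v.1) (one v.1)).eval ((v.1.residueCard : ℂ) ^ (-s)))⁻¹ := by
    intro s hs
    rw [eLν s]
    exact hJ1b hS sub₂ hτνS hτ₀S huνS huone (s := s - ((((-(3 * t) : ℝ)) : ℂ) + 0))
      (by rw [reν]; linarith)
  have mZ : ∀ s : ℂ, 1 < s.re → Multipliable fun v : {v : HeightOneSpectrum (𝓞 F) // v ∉ S} =>
      ((satakePairPolynomial (one v.1) (one v.1)).eval ((v.1.residueCard : ℂ) ^ (-s)))⁻¹ :=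
    fun s hs => hJ1c hS sub₃ hτ₀S hτ₀S huone huone hs
  have mF₂ : ∀ s : ℂ, 1 < s.re → Multipliable fun v : {v : HeightOneSpectrum (𝓞 F) // v ∉ S} =>
      ((satakePairPolynomial (γ v.1) (sδ v.1)).eval ((v.1.residueCard : ℂ) ^ (-s)))⁻¹ := by
    intro s hs
    rw [eF₂ s]
    exact hmQ hS hTS' (s - (0 + (((-(2 * t) : ℝ)) : ℂ))) (by rw [re₂]; linarith)
  -- (L-eq) on `Re s > 1`
  have hEq : ∀ᶠ s in 𝓝[{s : ℂ | 1 < s.re}] 1,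
      partialPairL S β su₁ s * partialPairL S suν one s =
        partialPairL S one one s * partialPairL S γ sδ s :=
    eventually_nhdsWithin_of_forall fun s hs =>
      partialPairL_mul_eq_of_satakePairPolynomial_mul_eq (fun v hv => hId v (hTS v hv))
        (mF₁ s hs) (mLν s hs) (mZ s hs) (mF₂ s hs)
  have hl : ∀ z : ℂ, Tendsto (fun s : ℂ => s - z) (𝓝[{s : ℂ | 1 < s.re}] 1) (𝓝 (1 - z)) :=
    fun z => ((continuous_id.sub continuous_const).tendsto 1).mono_left nhdsWithin_le_nhds
  -- `A(s + t) → A(1 + t)`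
  have hcA := hcP hS hTS' (1 - (0 + (((-t : ℝ)) : ℂ))) (by rw [re₁, Complex.one_re]; linarith)
  have hF₁ : Tendsto (partialPairL S β su₁) (𝓝[{s : ℂ | 1 < s.re}] 1)
      (𝓝 (partialPairL S β u₁ (1 - (0 + (((-t : ℝ)) : ℂ))))) := by
    rw [pF₁]
    exact hcA.tendsto.comp (hl _)
  -- `N(s + 3t) → N(1 + 3t)`
  obtain ⟨hcN, -⟩ := hIb hS sub₆ hτνS hτ₀S huνS huone (s := 1 - ((((-(3 * t) : ℝ)) : ℂ) + 0))
    (by rw [reν, Complex.one_re]; linarith)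
  have hLν : Tendsto (partialPairL S suν one) (𝓝[{s : ℂ | 1 < s.re}] 1)
      (𝓝 (partialPairL S uν one (1 - ((((-(3 * t) : ℝ)) : ℂ) + 0)))) := by
    rw [pLν]
    exact hcN.tendsto.comp (hl _)
  -- Hecke: `(s - 1) ζ_F^S(s) → c₀ ≠ 0`
  obtain ⟨c₀, hc₀, hZ⟩ := tendsto_sub_one_mul_partialPairL_one_one hS hone
  -- `C(s + 2t) → C(1 + 2t) ≠ 0`
  obtain ⟨hcC, hC0⟩ := hcQ hS hTS' (1 - (0 + (((-(2 * t) : ℝ)) : ℂ)))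
    (by rw [re₂, Complex.one_re]; linarith)
  have hF₂ : Tendsto (partialPairL S γ sδ) (𝓝[{s : ℂ | 1 < s.re}] 1)
      (𝓝 (partialPairL S γ δ₁ (1 - (0 + (((-(2 * t) : ℝ)) : ℂ))))) := by
    rw [pF₂]
    exact hcC.tendsto.comp (hl _)
  exact false_of_pole_times_nonzero_eq_finite (l := 𝓝[{s : ℂ | 1 < s.re}] 1)
    tendsto_sub_one_nhdsWithin_one_lt_re hEq hF₁ hLν hZ hc₀ hF₂ hC0

/-- **No "large" Hecke character among a unitary Satake family on `GL(3)`, with abstract slots.**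
Let `β` be a family of multisets of cardinal `3` without `0`, unitary a.e., `Ω` a Hecke character with
`Ω(ϖ_w) = det β_w` a.e., and suppose the pairs `(β, {u(ϖ)})` and `(β⁻¹, {u(ϖ)})` have analytic
packages (multipliable, continuous and non-zero on `Re s > 1`, off every large finite `S`) for every
Hecke character `u` unitary a.e. — supplied for a cuspidal Borel–Jacquet datum by
`analyticPackage_repData` and `analyticPackage_dual`.  If `θ` is a Hecke character with
`θ(ϖ_w) ∈ β_w` a.e. and `|θ| = ‖·‖^{-t}`, `t > 0`, then `False`: the data of
`false_of_large_heckeCharacter_mem_satake` (`u₁ = θ⁻¹‖·‖^{-t}`, `κ₁ = u₁² Ω`, `uν = κ₁ u₁`) satisfy the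
shifted (L-eq) of `false_of_eulerIdentity_of_shift_of_packages`, with the second `GL_3` pair
`(β⁻¹, {κ₁(ϖ)})` (`satakePairPolynomial_bh_identity`, `satakePairPolynomial_map_mul_one`).
[cite: BockleHui2025, §3.2.1] -/
theorem false_of_large_heckeCharacter_mem_satake'
    (β : SatakeFamily F)
    (huβ : ∀ᶠ w : HeightOneSpectrum (𝓞 F) in cofinite, ‖(β w).prod‖ = 1)
    (hβ0 : ∀ᶠ w : HeightOneSpectrum (𝓞 F) in cofinite, (0 : ℂ) ∉ β w)
    (hcard : ∀ᶠ w : HeightOneSpectrum (𝓞 F) in cofinite, Multiset.card (β w) = 3)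
    (Ω : HeckeCharacter F)
    (hΩ : ∀ᶠ w : HeightOneSpectrum (𝓞 F) in cofinite, Ω.valueAtUniformizer w = (β w).prod)
    (packP : ∀ u : HeckeCharacter F,
      (∀ᶠ w : HeightOneSpectrum (𝓞 F) in cofinite, ‖u.valueAtUniformizer w‖ = 1) →
      ∃ S₀ : Set (HeightOneSpectrum (𝓞 F)), S₀.Finite ∧
        ∀ {S : Set (HeightOneSpectrum (𝓞 F))} (_hS : S.Finite) (_hS₀ : S₀ ⊆ S),
          (∀ s : ℂ, 1 < s.re → Multipliable fun v : {v : HeightOneSpectrum (𝓞 F) // v ∉ S} =>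
            ((satakePairPolynomial (β v.1) {u.valueAtUniformizer v.1}).eval
              ((v.1.residueCard : ℂ) ^ (-s)))⁻¹) ∧
          (∀ s : ℂ, 1 < s.re →
            ContinuousAt (partialPairL S β (fun w => {u.valueAtUniformizer w})) s ∧
              partialPairL S β (fun w => {u.valueAtUniformizer w}) s ≠ 0))
    (packQ : ∀ u : HeckeCharacter F,
      (∀ᶠ w : HeightOneSpectrum (𝓞 F) in cofinite, ‖u.valueAtUniformizer w‖ = 1) →
      ∃ S₀ : Set (HeightOneSpectrum (𝓞 F)), S₀.Finite ∧
        ∀ {S : Set (HeightOneSpectrum (𝓞 F))} (_hS : S.Finite) (_hS₀ : S₀ ⊆ S),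
          (∀ s : ℂ, 1 < s.re → Multipliable fun v : {v : HeightOneSpectrum (𝓞 F) // v ∉ S} =>
            ((satakePairPolynomial ((β v.1).map (·⁻¹)) {u.valueAtUniformizer v.1}).eval
              ((v.1.residueCard : ℂ) ^ (-s)))⁻¹) ∧
          (∀ s : ℂ, 1 < s.re →
            ContinuousAt (partialPairL S (fun w => (β w).map (·⁻¹)) (fun w => {u.valueAtUniformizer w}))
                s ∧
              partialPairL S (fun w => (β w).map (·⁻¹)) (fun w => {u.valueAtUniformizer w}) s ≠ 0))
    (θ : HeckeCharacter F)
    (hθ : ∀ᶠ w : HeightOneSpectrum (𝓞 F) in cofinite, θ.valueAtUniformizer w ∈ β w)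
    {t : ℝ} (ht : 0 < t)
    (hθt : ∀ x : ideleGroup F, ‖((θ x : ℂˣ) : ℂ)‖ = GaloisRepresentations.ideleNorm x ^ (-t)) :
    False := by
  have h1 : isCompact_glFiniteIntegralLevel 1 F := isCompact_glFiniteIntegralLevel_holds 1 F
  obtain ⟨lam, hlam⟩ := exists_heckeCharacter_ideleNorm_cpow F (((-t : ℝ)) : ℂ)
  have hc : ∀ w : HeightOneSpectrum (𝓞 F),
      lam.valueAtUniformizer w = ((w.residueCard : ℂ) ^ (((-t : ℝ)) : ℂ))⁻¹ :=
    HeckeCharacter.valueAtUniformizer_of_cpow hlam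
  have hc0 : ∀ w : HeightOneSpectrum (𝓞 F), (w.residueCard : ℂ) ^ (((-t : ℝ)) : ℂ) ≠ 0 :=
    fun w => nc_qpow_ne_zero w _
  have hnc : ∀ w : HeightOneSpectrum (𝓞 F),
      ‖(w.residueCard : ℂ) ^ (((-t : ℝ)) : ℂ)‖ = (w.residueCard : ℝ) ^ (-t) := fun w => by
    rw [nc_norm_qpow, Complex.ofReal_re]
  have hnθ : ∀ w : HeightOneSpectrum (𝓞 F), ‖θ.valueAtUniformizer w‖ = (w.residueCard : ℝ) ^ t :=
    fun w => by rw [nc_norm_vAU_eq_rpow_neg hθt, neg_neg]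
  -- the unitary characters
  set u₁ : HeckeCharacter F := θ⁻¹ * lam with hu₁def
  set κ₁ : HeckeCharacter F := u₁ * u₁ * Ω with hκ₁def
  set uν : HeckeCharacter F := κ₁ * u₁ with huνdef
  have hu₁w : ∀ w, u₁.valueAtUniformizer w =
      (θ.valueAtUniformizer w)⁻¹ * ((w.residueCard : ℂ) ^ (((-t : ℝ)) : ℂ))⁻¹ := fun w => by
    rw [hu₁def, valueAtUniformizer_mul, valueAtUniformizer_inv, hc]
  have hθinv : ∀ w, (θ.valueAtUniformizer w)⁻¹ =
      (w.residueCard : ℂ) ^ (((-t : ℝ)) : ℂ) * u₁.valueAtUniformizer w := fun w => by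
    rw [hu₁w, mul_comm ((θ.valueAtUniformizer w)⁻¹), ← mul_assoc, mul_inv_cancel₀ (hc0 w), one_mul]
  have hκ₁w : ∀ w, κ₁.valueAtUniformizer w =
      u₁.valueAtUniformizer w * u₁.valueAtUniformizer w * Ω.valueAtUniformizer w := fun w => by
    rw [hκ₁def, valueAtUniformizer_mul, valueAtUniformizer_mul]
  have huνw : ∀ w, uν.valueAtUniformizer w = κ₁.valueAtUniformizer w * u₁.valueAtUniformizer w :=
    fun w => by rw [huνdef, valueAtUniformizer_mul]
  have hnu₁ : ∀ w, ‖u₁.valueAtUniformizer w‖ = 1 := fun w => by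
    have hq : (0 : ℝ) < w.residueCard := by exact_mod_cast lt_trans zero_lt_one w.one_lt_residueCard
    rw [hu₁w, norm_mul, norm_inv, norm_inv, hnθ, hnc, Real.rpow_neg hq.le, inv_inv,
      inv_mul_cancel₀ (Real.rpow_pos_of_pos hq t).ne']
  have hnκ₁ : ∀ᶠ w : HeightOneSpectrum (𝓞 F) in cofinite, ‖κ₁.valueAtUniformizer w‖ = 1 := by
    filter_upwards [hΩ, huβ] with w hΩw huw
    rw [hκ₁w, norm_mul, norm_mul, hnu₁, hΩw, huw, one_mul, one_mul]
  have hnuν : ∀ᶠ w : HeightOneSpectrum (𝓞 F) in cofinite, ‖uν.valueAtUniformizer w‖ = 1 := by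
    filter_upwards [hnκ₁] with w hw
    rw [huνw, norm_mul, hw, hnu₁, one_mul]
  -- the `GL_1` data and the packages
  obtain ⟨τ₀, hτ₀⟩ := exists_cuspidal_glOne_hasSatakeParamAt_one h1
  obtain ⟨τν, hτν⟩ := exists_cuspidal_glOne_hasSatakeParamAt_valueAtUniformizer h1 uν
  obtain ⟨SP, hSP, hPk⟩ := packP u₁ (Filter.Eventually.of_forall hnu₁)
  obtain ⟨SQ, hSQ, hQk⟩ := packQ κ₁ hnκ₁
  -- the good places
  have hgood : ∀ᶠ w : HeightOneSpectrum (𝓞 F) in cofinite,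
      Ω.valueAtUniformizer w = (β w).prod ∧ θ.valueAtUniformizer w ∈ β w ∧ ‖(β w).prod‖ = 1 ∧
      (0 : ℂ) ∉ β w ∧ Multiset.card (β w) = 3 ∧ ‖uν.valueAtUniformizer w‖ = 1 ∧
      τ₀.1.HasSatakeParamAt w {1} ∧ τν.1.HasSatakeParamAt w {uν.valueAtUniformizer w} := by
    filter_upwards [hΩ, hθ, huβ, hβ0, hcard, hnuν, hτ₀, hτν] with w h₁ h₂ h₃ h₄ h₅ h₆ h₇ h₈
    exact ⟨h₁, h₂, h₃, h₄, h₅, h₆, h₇, h₈⟩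
  obtain ⟨T₀, hT₀, hgoodT⟩ : ∃ T₀ : Set (HeightOneSpectrum (𝓞 F)), T₀.Finite ∧ ∀ w ∉ T₀,
      Ω.valueAtUniformizer w = (β w).prod ∧ θ.valueAtUniformizer w ∈ β w ∧ ‖(β w).prod‖ = 1 ∧
      (0 : ℂ) ∉ β w ∧ Multiset.card (β w) = 3 ∧ ‖uν.valueAtUniformizer w‖ = 1 ∧
      τ₀.1.HasSatakeParamAt w {1} ∧ τν.1.HasSatakeParamAt w {uν.valueAtUniformizer w} :=
    ⟨_, Filter.eventually_cofinite.1 hgood, fun w hw => not_not.1 hw⟩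
  set T : Set (HeightOneSpectrum (𝓞 F)) := T₀ ∪ SP ∪ SQ with hT_def
  have hT : T.Finite := (hT₀.union hSP).union hSQ
  have hT₀T : ∀ w ∉ T, w ∉ T₀ := fun w hw h => hw (by simp [hT_def, h])
  have subP : SP ⊆ T := fun x hx => by simp [hT_def, hx]
  have subQ : SQ ⊆ T := fun x hx => by simp [hT_def, hx]
  -- powers of the local constant
  have hc2 : ∀ w : HeightOneSpectrum (𝓞 F),
      (w.residueCard : ℂ) ^ (((-(2 * t) : ℝ)) : ℂ) = ((w.residueCard : ℂ) ^ (((-t : ℝ)) : ℂ)) ^ 2 :=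
    fun w => by
    rw [← Complex.cpow_nat_mul]; congr 1; push_cast; ring
  have hc3 : ∀ w : HeightOneSpectrum (𝓞 F),
      (w.residueCard : ℂ) ^ (((-(3 * t) : ℝ)) : ℂ) = ((w.residueCard : ℂ) ^ (((-t : ℝ)) : ℂ)) ^ 3 :=
    fun w => by
    rw [← Complex.cpow_nat_mul]; congr 1; push_cast; ring
  -- the Euler-factor identity at a good place
  have hId : ∀ w ∉ T,
      satakePairPolynomial (β w)
            (({u₁.valueAtUniformizer w} : Multiset ℂ).map
              (((w.residueCard : ℂ) ^ (((-t : ℝ)) : ℂ)) * ·)) *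
          satakePairPolynomial
            (({uν.valueAtUniformizer w} : Multiset ℂ).map
              (((w.residueCard : ℂ) ^ (((-(3 * t) : ℝ)) : ℂ)) * ·)) {1} =
        satakePairPolynomial {1} {1} *
          satakePairPolynomial ((β w).map (·⁻¹))
            (({κ₁.valueAtUniformizer w} : Multiset ℂ).map
              (((w.residueCard : ℂ) ^ (((-(2 * t) : ℝ)) : ℂ)) * ·)) := by
    intro w hw
    have hg := hgoodT w (hT₀T w hw)
    obtain ⟨γ, hγ⟩ := Multiset.exists_cons_of_mem hg.2.1
    have hcardγ : Multiset.card γ = 2 := by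
      have h3c := hg.2.2.2.2.1
      rw [hγ, Multiset.card_cons] at h3c
      omega
    obtain ⟨b, c, rfl⟩ := Multiset.card_eq_two.1 hcardγ
    have hθ0 : θ.valueAtUniformizer w ≠ 0 := heckeCharacter_valueAtUniformizer_ne_zero θ w
    have hC0 : (w.residueCard : ℂ) ^ (((-t : ℝ)) : ℂ) ≠ 0 := hc0 w
    have hb : b ≠ 0 := fun h => hg.2.2.2.1 (by rw [hγ, h]; simp)
    have hcc : c ≠ 0 := fun h => hg.2.2.2.1 (by rw [hγ, h]; simp)
    have hprodγ : (β w).prod = θ.valueAtUniformizer w * (b * c) := by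
      rw [hγ, Multiset.prod_cons, Multiset.insert_eq_cons, Multiset.prod_cons, Multiset.prod_singleton]
    have e1 : ({u₁.valueAtUniformizer w} : Multiset ℂ).map
        (((w.residueCard : ℂ) ^ (((-t : ℝ)) : ℂ)) * ·) = {(θ.valueAtUniformizer w)⁻¹} := by
      rw [Multiset.map_singleton, ← hθinv]
    have e2 : (w.residueCard : ℂ) ^ (((-(2 * t) : ℝ)) : ℂ) * κ₁.valueAtUniformizer w =
        (θ.valueAtUniformizer w)⁻¹ * (b * c) := by
      rw [hc2, hκ₁w, hg.1, hprodγ, hu₁w]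
      field_simp
    have e3 : ({uν.valueAtUniformizer w} : Multiset ℂ).map
        (((w.residueCard : ℂ) ^ (((-(3 * t) : ℝ)) : ℂ)) * ·) =
          {(θ.valueAtUniformizer w)⁻¹ * (b * c) * (θ.valueAtUniformizer w)⁻¹} := by
      rw [Multiset.map_singleton]
      congr 1
      rw [hc3, huνw, hκ₁w, hg.1, hprodγ, hu₁w]
      field_simp
    have e4 : ({κ₁.valueAtUniformizer w} : Multiset ℂ).map
        (((w.residueCard : ℂ) ^ (((-(2 * t) : ℝ)) : ℂ)) * ·) =
          {(θ.valueAtUniformizer w)⁻¹ * (b * c)} := by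
      rw [Multiset.map_singleton, e2]
    have key := satakePairPolynomial_bh_identity hθ0 hb hcc
    rw [satakePairPolynomial_map_mul_one] at key
    rw [e1, e3, e4, hγ]
    exact key
  -- conclude
  exact false_of_eulerIdentity_of_shift_of_packages τ₀ τν (fun _ => {1})
    (fun w => {u₁.valueAtUniformizer w}) (fun w => {uν.valueAtUniformizer w}) β
    (fun w => (β w).map (·⁻¹)) (fun w => {κ₁.valueAtUniformizer w}) hT (fun _ => rfl)
    (fun w hw => (hgoodT w (hT₀T w hw)).2.2.2.2.2.2.1)
    (fun w hw => (hgoodT w (hT₀T w hw)).2.2.2.2.2.2.2)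
    (fun w hw => by rw [Multiset.prod_singleton]; exact (hgoodT w (hT₀T w hw)).2.2.2.2.2.1)
    (fun hS hTS s hs => (hPk hS (subP.trans hTS)).1 s hs)
    (fun hS hTS s hs => ((hPk hS (subP.trans hTS)).2 s hs).1)
    (fun hS hTS s hs => (hQk hS (subQ.trans hTS)).1 s hs)
    (fun hS hTS s hs => (hQk hS (subQ.trans hTS)).2 s hs) ht hId

end Abstract

/-! ### The weight condition and the analytic case without the contragredient datum -/

section NoContragredient

variable {F : Type} [Field F] [NumberField F]

/-- **The weight condition (`hpin`) without the contragredient datum.**  Granting Jacquet–Shalika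
(2.2) for Borel–Jacquet data and the two `L²` leaves `…_at_one_of_rank_ne`, `…_boundary_of_ne_one`: for
a cuspidal `π` on `GL_3(𝔸_F)` and a Hecke character `μ` with `μ(ϖ_v) ∈ t_{π,v}` a.e.,
`‖∏ t_{π,v}‖ = ‖μ(ϖ_v)‖³` a.e.  As `norm_prod_satake_eq_norm_cube_of_JS`, with
`false_of_large_heckeCharacter_mem_satake'` fed by `analyticPackage_repData` / `analyticPackage_dual`
for the unitary normalisation `π₀` (case `d < 0`) and, for `d > 0`, by the same two packages with the
roles of `β` and `β⁻¹` exchanged. [cite: BockleHui2025, §3.2.1] -/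
theorem norm_prod_satake_eq_norm_cube
    (hJ2 : JacquetShalika1981_partialPairL_boundary_repData)
    (hrk : ∀ {n m : ℕ} {K : Type} [Field K] [NumberField K]
      {μ : Measure (gl n K).automorphicQuotient} [(gl n K).IsAutomorphicMeasure μ]
      {μ' : Measure (gl m K).automorphicQuotient} [(gl m K).IsAutomorphicMeasure μ'],
      JacquetShalika1981_partialPairL_at_one_of_rank_ne (n := n) (m := m) (K := K) (μ := μ)
        (μ' := μ'))
    (h22' : ∀ {n m : ℕ} {K : Type} [Field K] [NumberField K]
      {μ : Measure (gl n K).automorphicQuotient} [(gl n K).IsAutomorphicMeasure μ]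
      {μ' : Measure (gl m K).automorphicQuotient} [(gl m K).IsAutomorphicMeasure μ'],
      JacquetShalika1981_partialPairL_boundary_of_ne_one (n := n) (m := m) (K := K) (μ := μ)
        (μ' := μ'))
    {h3 : isCompact_glFiniteIntegralLevel 3 F}
    (π : CuspidalAutomorphicRepData 3 F h3) {μ : HeckeCharacter F}
    (hμ : ∀ᶠ v : HeightOneSpectrum (𝓞 F) in cofinite, ∀ α : Multiset ℂ,
      π.1.HasSatakeParamAt v α → μ.valueAtUniformizer v ∈ α) :
    ∀ᶠ v : HeightOneSpectrum (𝓞 F) in cofinite, ∀ α : Multiset ℂ,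
      π.1.HasSatakeParamAt v α → ‖α.prod‖ = ‖μ.valueAtUniformizer v‖ ^ 3 := by
  haveI : NeZero (3 : ℕ) := ⟨by norm_num⟩
  obtain ⟨Ω, hΩ⟩ := exists_heckeCharacter_prod_satake' π
  obtain ⟨σΩ, hσΩ⟩ := Ω.exists_norm_apply_eq_ideleNorm_rpow
  obtain ⟨σμ, hσμ⟩ := μ.exists_norm_apply_eq_ideleNorm_rpow
  have hnΩ : ∀ w, ‖Ω.valueAtUniformizer w‖ = (w.residueCard : ℝ) ^ (-σΩ) := nc_norm_vAU_eq_rpow_neg hσΩ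
  have hnμ : ∀ w, ‖μ.valueAtUniformizer w‖ = (w.residueCard : ℝ) ^ (-σμ) := nc_norm_vAU_eq_rpow_neg hσμ
  by_cases hd : σΩ = 3 * σμ
  · filter_upwards [hΩ] with v hΩv α hα
    have hq : (0 : ℝ) ≤ v.residueCard := Nat.cast_nonneg _
    rw [← hΩv α hα, hnΩ, hnμ, hd, ← Real.rpow_natCast, ← Real.rpow_mul hq]
    congr 1
    push_cast
    ring
  · exfalso
    -- the unitary normalisation `P = π ⊗ ‖·‖^{-σΩ/3}` and `θ = ‖·‖^{-σΩ/3} μ`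
    obtain ⟨lam, hlam⟩ := exists_heckeCharacter_ideleNorm_cpow F (((-(σΩ / 3)) : ℝ) : ℂ)
    have hnlam : ∀ x : ideleGroup F,
        ‖((lam x : ℂˣ) : ℂ)‖ = GaloisRepresentations.ideleNorm x ^ (-(σΩ / 3)) := fun x => by
      rw [hlam x, Complex.norm_cpow_eq_rpow_re_of_pos (ideleNorm_pos' _ x), Complex.ofReal_re]
    have hnlamw : ∀ w, ‖lam.valueAtUniformizer w‖ = (w.residueCard : ℝ) ^ (σΩ / 3) := fun w => by
      rw [nc_norm_vAU_eq_rpow_neg hnlam, neg_neg]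
    obtain ⟨P, hP⟩ := CuspidalAutomorphicRepData.exists_twist_hecke_hasSatakeParamAt lam π
    obtain ⟨απ, eπ⟩ := nc_exists_satakeFamily_of π.1
    set β : SatakeFamily F := fun w => (απ w).map (lam.valueAtUniformizer w * ·) with hβdef
    set θ : HeckeCharacter F := lam * μ with hθdef
    have hPβ : ∀ᶠ w : HeightOneSpectrum (𝓞 F) in cofinite, P.1.HasSatakeParamAt w (β w) := by
      filter_upwards [eπ, hP] with w hw hPw
      exact hPw _ hw
    have hΩβ : ∀ᶠ w : HeightOneSpectrum (𝓞 F) in cofinite,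
        (lam ^ 3 * Ω).valueAtUniformizer w = (β w).prod := by
      filter_upwards [eπ, hΩ] with w hw hΩw
      show _ = ((απ w).map (lam.valueAtUniformizer w * ·)).prod
      rw [prod_map_const_mul_eq, hw.card_eq, ← hΩw _ hw, valueAtUniformizer_mul, valueAtUniformizer_pow]
    have huβ : ∀ᶠ w : HeightOneSpectrum (𝓞 F) in cofinite, ‖(β w).prod‖ = 1 := by
      filter_upwards [eπ, hΩ] with w hw hΩw
      have hq : (0 : ℝ) < w.residueCard := by exact_mod_cast lt_trans zero_lt_one w.one_lt_residueCard
      show ‖((απ w).map (lam.valueAtUniformizer w * ·)).prod‖ = 1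
      rw [prod_map_const_mul_eq, hw.card_eq, ← hΩw _ hw, norm_mul, norm_pow, hnlamw, hnΩ,
        ← Real.rpow_natCast, ← Real.rpow_mul hq.le, ← Real.rpow_add hq,
        show σΩ / 3 * ((3 : ℕ) : ℝ) + -σΩ = 0 by push_cast; ring, Real.rpow_zero]
    have hβ0 : ∀ᶠ w : HeightOneSpectrum (𝓞 F) in cofinite, (0 : ℂ) ∉ β w :=
      hPβ.mono fun w hw h0 => hasSatakeParamAt_ne_zero_holds hw 0 h0 rfl
    have hcard : ∀ᶠ w : HeightOneSpectrum (𝓞 F) in cofinite, Multiset.card (β w) = 3 :=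
      hPβ.mono fun w hw => hw.card_eq
    have hθβ : ∀ᶠ w : HeightOneSpectrum (𝓞 F) in cofinite, θ.valueAtUniformizer w ∈ β w := by
      filter_upwards [eπ, hμ] with w hw hμw
      show θ.valueAtUniformizer w ∈ (απ w).map (lam.valueAtUniformizer w * ·)
      rw [hθdef, valueAtUniformizer_mul]
      exact Multiset.mem_map_of_mem _ (hμw _ hw)
    have hnθ : ∀ x : ideleGroup F,
        ‖((θ x : ℂˣ) : ℂ)‖ = GaloisRepresentations.ideleNorm x ^ (σμ - σΩ / 3) := fun x => by
      rw [hθdef, GaloisRepresentations.HeckeCharacter.mul_apply, Units.val_mul, norm_mul, hnlam x,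
        hσμ x, ← Real.rpow_add (ideleNorm_pos' _ x)]
      congr 1
      ring
    -- the packages of `P` and of its dual
    have packP := fun (u : HeckeCharacter F)
        (hu : ∀ᶠ w : HeightOneSpectrum (𝓞 F) in cofinite, ‖u.valueAtUniformizer w‖ = 1) =>
      analyticPackage_repData hJ2 (n := 3) (by norm_num) P β hPβ huβ u hu
    have packQ := fun (u : HeckeCharacter F)
        (hu : ∀ᶠ w : HeightOneSpectrum (𝓞 F) in cofinite, ‖u.valueAtUniformizer w‖ = 1) =>
      analyticPackage_dual hrk h22' (n := 3) (by norm_num) P β hPβ huβ u hu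
    rcases lt_or_gt_of_ne (show σμ - σΩ / 3 ≠ 0 by intro h; exact hd (by linarith)) with hlt | hgt
    · -- `d < 0`: `|θ(ϖ)| = q^{-d} > 1`
      refine false_of_large_heckeCharacter_mem_satake' β huβ hβ0 hcard (lam ^ 3 * Ω) hΩβ
        (fun u hu => ?_) (fun u hu => ?_) θ hθβ (t := -(σμ - σΩ / 3)) (by linarith) (fun x => ?_)
      · obtain ⟨S₀, hS₀, h⟩ := packP u hu
        exact ⟨S₀, hS₀, fun hS hsub => ⟨(h hS hsub).1, (h hS hsub).2.1⟩⟩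
      · obtain ⟨S₀, hS₀, h⟩ := packQ u hu
        exact ⟨S₀, hS₀, fun hS hsub => ⟨(h hS hsub).1, (h hS hsub).2.1⟩⟩
      · rw [hnθ x, neg_neg]
    · -- `d > 0`: the dual data `(β⁻¹, Ω⁻¹, θ⁻¹)`
      refine false_of_large_heckeCharacter_mem_satake' (fun w => (β w).map (·⁻¹))
        (huβ.mono fun w hw => by rw [Multiset.prod_map_inv, Multiset.map_id', norm_inv, hw, inv_one])
        (hβ0.mono fun w hw h0 => hw ?_) (hcard.mono fun w hw => by rw [Multiset.card_map, hw])
        (lam ^ 3 * Ω)⁻¹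
        (hΩβ.mono fun w hw => by rw [valueAtUniformizer_inv, hw, Multiset.prod_map_inv, Multiset.map_id'])
        (fun u hu => ?_) (fun u hu => ?_) θ⁻¹
        (hθβ.mono fun w hw => by rw [valueAtUniformizer_inv]; exact Multiset.mem_map_of_mem _ hw)
        (t := σμ - σΩ / 3) hgt (fun x => ?_)
      · obtain ⟨x, hx, hx0⟩ := Multiset.mem_map.1 h0
        rwa [inv_eq_zero.1 hx0] at hx
      · obtain ⟨S₀, hS₀, h⟩ := packQ u hu
        exact ⟨S₀, hS₀, fun hS hsub => ⟨(h hS hsub).1, (h hS hsub).2.1⟩⟩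
      · obtain ⟨S₀, hS₀, h⟩ := packP u hu
        refine ⟨S₀, hS₀, fun hS hsub => ?_⟩
        simp only [satakeParam_inv_inv]
        exact ⟨(h hS hsub).1, (h hS hsub).2.1⟩
      · rw [GaloisRepresentations.HeckeCharacter.inv_apply, Units.val_inv_eq_inv_val, norm_inv, hnθ x,
          Real.rpow_neg (ideleNorm_pos' _ x).le]

/-- **BH §3.2.1, the analytic case, without the contragredient datum**: granting Jacquet–Shalika
(2.2) for Borel–Jacquet data and the two `L²` leaves `JacquetShalika1981_partialPairL_at_one_of_rank_ne`,
`…_boundary_of_ne_one`, for a cuspidal `π` on `GL_3(𝔸_F)` and a Hecke character `μ` with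
`μ(ϖ_v) ∈ t_{π,v}` a.e., `∏ t_{π,v} = μ(ϖ_v)³` a.e.  Same construction as `prod_satake_eq_cube_of_JS`
(`π₀ = π ⊗ ‖·‖^{-σ}`, `θ = ‖·‖^{-σ} μ` unitary by `norm_prod_satake_eq_norm_cube`,
`κ = θ^{-2} ω_{π₀}`, `ν = κ θ⁻¹`; "Suppose `det(σ_λ)·τ_λ^{-2}` is non-trivial … We get a contradiction"),
with the slot of `L^S(s, π₀ × θ⁻¹)` filled by `analyticPackage_repData` and that of
`L^S(s, Alt²(π₀) ⊗ θ^{-2}) = L^S(s, π₀^∨ × κ)` by `analyticPackage_dual`, in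
`eventually_eq_one_of_eulerIdentity_of_packages`. [cite: BockleHui2025, §3.2.1]
[cite: ArthurClozelAMS120, Ch. 3 §2 (2.1)–(2.2)] -/
theorem prod_satake_eq_cube
    (hJ2 : JacquetShalika1981_partialPairL_boundary_repData)
    (hrk : ∀ {n m : ℕ} {K : Type} [Field K] [NumberField K]
      {μ : Measure (gl n K).automorphicQuotient} [(gl n K).IsAutomorphicMeasure μ]
      {μ' : Measure (gl m K).automorphicQuotient} [(gl m K).IsAutomorphicMeasure μ'],
      JacquetShalika1981_partialPairL_at_one_of_rank_ne (n := n) (m := m) (K := K) (μ := μ)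
        (μ' := μ'))
    (h22' : ∀ {n m : ℕ} {K : Type} [Field K] [NumberField K]
      {μ : Measure (gl n K).automorphicQuotient} [(gl n K).IsAutomorphicMeasure μ]
      {μ' : Measure (gl m K).automorphicQuotient} [(gl m K).IsAutomorphicMeasure μ'],
      JacquetShalika1981_partialPairL_boundary_of_ne_one (n := n) (m := m) (K := K) (μ := μ)
        (μ' := μ'))
    {h3 : isCompact_glFiniteIntegralLevel 3 F}
    (π : CuspidalAutomorphicRepData 3 F h3) {μ : HeckeCharacter F}
    (hμ : ∀ᶠ v : HeightOneSpectrum (𝓞 F) in cofinite, ∀ α : Multiset ℂ,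
      π.1.HasSatakeParamAt v α → μ.valueAtUniformizer v ∈ α) :
    ∀ᶠ v : HeightOneSpectrum (𝓞 F) in cofinite, ∀ α : Multiset ℂ,
      π.1.HasSatakeParamAt v α → α.prod = μ.valueAtUniformizer v ^ 3 := by
  haveI : NeZero (3 : ℕ) := ⟨by norm_num⟩
  have h1 : isCompact_glFiniteIntegralLevel 1 F := isCompact_glFiniteIntegralLevel_holds 1 F
  obtain ⟨Ω, hΩ⟩ := exists_heckeCharacter_prod_satake' π
  have hpin := norm_prod_satake_eq_norm_cube hJ2 hrk h22' π hμ
  -- the unitary normalisation: `|μ| = ‖·‖^σ`, `lam = ‖·‖^{-σ}`, `θ = lam μ` unitary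
  obtain ⟨σ, hσ⟩ := μ.exists_norm_apply_eq_ideleNorm_rpow
  obtain ⟨lam, hlam⟩ := exists_heckeCharacter_ideleNorm_cpow F ((-σ : ℝ) : ℂ)
  have hθu : ∀ x : ideleGroup F, ‖((lam x : ℂˣ) : ℂ)‖ * ‖((μ x : ℂˣ) : ℂ)‖ = 1 := by
    intro x
    rw [hlam x, Complex.norm_cpow_eq_rpow_re_of_pos (ideleNorm_pos' _ x), Complex.ofReal_re, hσ x,
      ← Real.rpow_add (ideleNorm_pos' _ x), neg_add_cancel, Real.rpow_zero]
  set θ : HeckeCharacter F := lam * μ with hθdef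
  have hθ1 : ∀ w : HeightOneSpectrum (𝓞 F), ‖θ.valueAtUniformizer w‖ = 1 := fun w => by
    rw [hθdef, valueAtUniformizer_mul, norm_mul, nc_vAU_apply, nc_vAU_apply]
    exact hθu _
  -- the data: `P = π ⊗ lam` with family `β`, `κ = θ⁻² ω_P`, `ν = κ θ⁻¹`, `τ₀ = 1`, `τν ↔ ν`
  obtain ⟨P, hP⟩ := CuspidalAutomorphicRepData.exists_twist_hecke_hasSatakeParamAt lam π
  set κ : HeckeCharacter F := θ⁻¹ * θ⁻¹ * (lam ^ 3 * Ω) with hκdef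
  set ν : HeckeCharacter F := κ * θ⁻¹ with hνdef
  obtain ⟨τ₀, hτ₀⟩ := exists_cuspidal_glOne_hasSatakeParamAt_one h1
  obtain ⟨τν, hτν⟩ := exists_cuspidal_glOne_hasSatakeParamAt_valueAtUniformizer h1 ν
  obtain ⟨απ, eπ⟩ := nc_exists_satakeFamily_of π.1
  set β : SatakeFamily F := fun w => (απ w).map (lam.valueAtUniformizer w * ·) with hβdef
  -- a.e. properties of `β`
  have hPβ : ∀ᶠ w : HeightOneSpectrum (𝓞 F) in cofinite, P.1.HasSatakeParamAt w (β w) := by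
    filter_upwards [eπ, hP] with w hw hPw
    exact hPw _ hw
  have hβprod : ∀ᶠ w : HeightOneSpectrum (𝓞 F) in cofinite,
      (β w).prod = lam.valueAtUniformizer w ^ 3 * Ω.valueAtUniformizer w := by
    filter_upwards [eπ, hΩ] with w hw hΩw
    show ((απ w).map (lam.valueAtUniformizer w * ·)).prod = _
    rw [prod_map_const_mul_eq, hw.card_eq, hΩw _ hw]
  have huβ : ∀ᶠ w : HeightOneSpectrum (𝓞 F) in cofinite, ‖(β w).prod‖ = 1 := by
    filter_upwards [eπ, hΩ, hpin, hβprod] with w hw hΩw hpw hprod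
    rw [hprod, norm_mul, norm_pow, hΩw _ hw, hpw _ hw, ← mul_pow, nc_vAU_apply, nc_vAU_apply, hθu,
      one_pow]
  have hθmem : ∀ᶠ w : HeightOneSpectrum (𝓞 F) in cofinite, θ.valueAtUniformizer w ∈ β w := by
    filter_upwards [eπ, hμ] with w hw hμw
    show θ.valueAtUniformizer w ∈ (απ w).map (lam.valueAtUniformizer w * ·)
    rw [hθdef, valueAtUniformizer_mul]
    exact Multiset.mem_map_of_mem _ (hμw _ hw)
  -- `κ`, `ν` at the places
  have hκ : ∀ᶠ w : HeightOneSpectrum (𝓞 F) in cofinite, κ.valueAtUniformizer w =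
      (θ.valueAtUniformizer w)⁻¹ * (θ.valueAtUniformizer w)⁻¹ * (β w).prod := by
    filter_upwards [hβprod] with w hprod
    rw [hκdef, valueAtUniformizer_mul, valueAtUniformizer_mul, valueAtUniformizer_mul, valueAtUniformizer_inv,
      valueAtUniformizer_pow, hprod]
  have hnκ : ∀ᶠ w : HeightOneSpectrum (𝓞 F) in cofinite, ‖κ.valueAtUniformizer w‖ = 1 := by
    filter_upwards [hκ, huβ] with w hκw huw
    rw [hκw, norm_mul, norm_mul, norm_inv, hθ1, huw, inv_one, one_mul, one_mul]
  have hν : ∀ w, ν.valueAtUniformizer w = κ.valueAtUniformizer w * (θ.valueAtUniformizer w)⁻¹ :=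
    fun w => by rw [hνdef, valueAtUniformizer_mul, valueAtUniformizer_inv]
  have hnν : ∀ᶠ w : HeightOneSpectrum (𝓞 F) in cofinite, ‖ν.valueAtUniformizer w‖ = 1 := by
    filter_upwards [hnκ] with w hw
    rw [hν, norm_mul, norm_inv, hw, hθ1, inv_one, one_mul]
  have hnθinv : ∀ᶠ w : HeightOneSpectrum (𝓞 F) in cofinite, ‖θ⁻¹.valueAtUniformizer w‖ = 1 :=
    Filter.Eventually.of_forall fun w => by rw [valueAtUniformizer_inv, norm_inv, hθ1, inv_one]
  -- the packages
  obtain ⟨SP, hSP, hPk⟩ := analyticPackage_repData hJ2 (n := 3) (by norm_num) P β hPβ huβ θ⁻¹ hnθinv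
  obtain ⟨SQ, hSQ, hQk⟩ := analyticPackage_dual hrk h22' (n := 3) (by norm_num) P β hPβ huβ κ hnκ
  -- the good places
  have hgood : ∀ᶠ w : HeightOneSpectrum (𝓞 F) in cofinite,
      π.1.HasSatakeParamAt w (απ w) ∧ P.1.HasSatakeParamAt w (β w) ∧
      (β w).prod = lam.valueAtUniformizer w ^ 3 * Ω.valueAtUniformizer w ∧
      θ.valueAtUniformizer w ∈ β w ∧
      κ.valueAtUniformizer w = (θ.valueAtUniformizer w)⁻¹ * (θ.valueAtUniformizer w)⁻¹ * (β w).prod ∧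
      ‖ν.valueAtUniformizer w‖ = 1 ∧
      τ₀.1.HasSatakeParamAt w {1} ∧ τν.1.HasSatakeParamAt w {ν.valueAtUniformizer w} := by
    filter_upwards [eπ, hPβ, hβprod, hθmem, hκ, hnν, hτ₀, hτν] with w h₁ h₂ h₃ h₄ h₅ h₆ h₇ h₈
    exact ⟨h₁, h₂, h₃, h₄, h₅, h₆, h₇, h₈⟩
  obtain ⟨T₀, hT₀, hgoodT⟩ : ∃ T₀ : Set (HeightOneSpectrum (𝓞 F)), T₀.Finite ∧ ∀ w ∉ T₀,
      π.1.HasSatakeParamAt w (απ w) ∧ P.1.HasSatakeParamAt w (β w) ∧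
      (β w).prod = lam.valueAtUniformizer w ^ 3 * Ω.valueAtUniformizer w ∧
      θ.valueAtUniformizer w ∈ β w ∧
      κ.valueAtUniformizer w = (θ.valueAtUniformizer w)⁻¹ * (θ.valueAtUniformizer w)⁻¹ * (β w).prod ∧
      ‖ν.valueAtUniformizer w‖ = 1 ∧
      τ₀.1.HasSatakeParamAt w {1} ∧ τν.1.HasSatakeParamAt w {ν.valueAtUniformizer w} :=
    ⟨_, Filter.eventually_cofinite.1 hgood, fun w hw => not_not.1 hw⟩
  set T : Set (HeightOneSpectrum (𝓞 F)) := T₀ ∪ SP ∪ SQ with hT_def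
  have hT : T.Finite := (hT₀.union hSP).union hSQ
  have hT₀T : ∀ w ∉ T, w ∉ T₀ := fun w hw h => hw (by simp [hT_def, h])
  have subP : SP ⊆ T := fun x hx => by simp [hT_def, hx]
  have subQ : SQ ⊆ T := fun x hx => by simp [hT_def, hx]
  -- the Euler-factor identity at a good place
  have hId : ∀ w ∉ T,
      satakePairPolynomial (β w) {θ⁻¹.valueAtUniformizer w} *
          satakePairPolynomial {ν.valueAtUniformizer w} {1} =
        satakePairPolynomial {1} {1} *
          satakePairPolynomial ((β w).map (·⁻¹)) {κ.valueAtUniformizer w} := by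
    intro w hw
    have hg := hgoodT w (hT₀T w hw)
    obtain ⟨γ, hγ⟩ := Multiset.exists_cons_of_mem hg.2.2.2.1
    have hcardβ : Multiset.card (β w) = 3 := hg.2.1.card_eq
    have hcardγ : Multiset.card γ = 2 := by
      rw [hγ, Multiset.card_cons] at hcardβ
      omega
    obtain ⟨b, c, rfl⟩ := Multiset.card_eq_two.1 hcardγ
    have hβ0 : (0 : ℂ) ∉ β w := fun h0 => hasSatakeParamAt_ne_zero_holds hg.2.1 0 h0 rfl
    have hθ0 : θ.valueAtUniformizer w ≠ 0 := heckeCharacter_valueAtUniformizer_ne_zero θ w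
    have hb : b ≠ 0 := fun h => hβ0 (by rw [hγ, h]; simp)
    have hcc : c ≠ 0 := fun h => hβ0 (by rw [hγ, h]; simp)
    have hprodγ : (β w).prod = θ.valueAtUniformizer w * (b * c) := by
      rw [hγ, Multiset.prod_cons, Multiset.insert_eq_cons, Multiset.prod_cons, Multiset.prod_singleton]
    have hκw : κ.valueAtUniformizer w = (θ.valueAtUniformizer w)⁻¹ * (b * c) := by
      rw [hg.2.2.2.2.1, hprodγ, mul_assoc, inv_mul_cancel_left₀ hθ0]
    have hνw : ν.valueAtUniformizer w =
        (θ.valueAtUniformizer w)⁻¹ * (b * c) * (θ.valueAtUniformizer w)⁻¹ := by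
      rw [hν, hκw]
    have key := satakePairPolynomial_bh_identity hθ0 hb hcc
    rw [satakePairPolynomial_map_mul_one] at key
    rw [valueAtUniformizer_inv, hνw, hκw, hγ]
    exact key
  -- the analytic core: `ν(ϖ_w) = 1` for almost all `w`
  have hX := eventually_eq_one_of_eulerIdentity_of_packages hJ2 τ₀ τν (fun _ => {1})
    (fun w => {θ⁻¹.valueAtUniformizer w}) (fun w => {ν.valueAtUniformizer w}) β
    (fun w => (β w).map (·⁻¹)) (fun w => {κ.valueAtUniformizer w}) hT (fun _ => rfl)
    (fun w hw => (hgoodT w (hT₀T w hw)).2.2.2.2.2.2.1)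
    (fun w hw => (hgoodT w (hT₀T w hw)).2.2.2.2.2.2.2)
    (fun w hw => by rw [Multiset.prod_singleton]; exact (hgoodT w (hT₀T w hw)).2.2.2.2.2.1)
    (fun hS hTS s hs => (hPk hS (subP.trans hTS)).1 s hs)
    (fun hS hTS => by
      obtain ⟨c, -, hc⟩ := (hPk hS (subP.trans hTS)).2.2
      exact ⟨c, hc⟩)
    (fun hS hTS s hs => (hQk hS (subQ.trans hTS)).1 s hs)
    (fun hS hTS => (hQk hS (subQ.trans hTS)).2.2) hId
  -- conclusion: `∏ α_w = μ(ϖ_w)³`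
  filter_upwards [hX, hT.eventually_cofinite_notMem] with w hXw hw α hα
  have hg := hgoodT w (hT₀T w hw)
  have e1 : ν.valueAtUniformizer w = 1 := by
    simpa [sub_self, Complex.cpow_zero] using hXw
  have hαe : α = απ w := π.1.hasSatakeParamAt_unique_holds hα hg.1
  have hθw : θ.valueAtUniformizer w = lam.valueAtUniformizer w * μ.valueAtUniformizer w := by
    rw [hθdef, valueAtUniformizer_mul]
  have hlam0 : lam.valueAtUniformizer w ≠ 0 := heckeCharacter_valueAtUniformizer_ne_zero lam w
  have hθ0 : θ.valueAtUniformizer w ≠ 0 := heckeCharacter_valueAtUniformizer_ne_zero θ w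
  rw [hν, hg.2.2.2.2.1, hg.2.2.1] at e1
  rw [hαe]
  have hβw : (β w).prod = lam.valueAtUniformizer w ^ 3 * (απ w).prod := by
    show ((απ w).map (lam.valueAtUniformizer w * ·)).prod = _
    rw [prod_map_const_mul_eq, hg.1.card_eq]
  have e2 : lam.valueAtUniformizer w ^ 3 * (απ w).prod = θ.valueAtUniformizer w ^ 3 := by
    have e1' : (θ.valueAtUniformizer w)⁻¹ * (θ.valueAtUniformizer w)⁻¹ *
        (lam.valueAtUniformizer w ^ 3 * Ω.valueAtUniformizer w) * (θ.valueAtUniformizer w)⁻¹ = 1 := e1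
    have hΩw : Ω.valueAtUniformizer w = (απ w).prod := by
      have := hg.2.2.1
      rw [hβw] at this
      exact mul_left_cancel₀ (pow_ne_zero 3 hlam0) this.symm
    rw [← hΩw]
    field_simp at e1'
    linear_combination e1'
  rw [hθw, mul_pow] at e2
  exact mul_left_cancel₀ (pow_ne_zero 3 hlam0) e2

end NoContragredient

/-! ### Assembly -/

section Assembly

/-- **`hB` of `lDichotomy_gl3_totallyReal_of_satakeLevel` without the contragredient datum**, from
Jacquet–Shalika (2.2) for Borel–Jacquet data and the `L²` leaves `…_at_one_of_rank_ne`,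
`…_boundary_of_ne_one` (`prod_satake_eq_cube`). [cite: BockleHui2025, §3.2.1] -/
theorem satakeLevel_analyticCase_noContragredient
    (hJ2 : JacquetShalika1981_partialPairL_boundary_repData)
    (hrk : ∀ {n m : ℕ} {K : Type} [Field K] [NumberField K]
      {μ : Measure (gl n K).automorphicQuotient} [(gl n K).IsAutomorphicMeasure μ]
      {μ' : Measure (gl m K).automorphicQuotient} [(gl m K).IsAutomorphicMeasure μ'],
      JacquetShalika1981_partialPairL_at_one_of_rank_ne (n := n) (m := m) (K := K) (μ := μ)
        (μ' := μ'))
    (h22' : ∀ {n m : ℕ} {K : Type} [Field K] [NumberField K]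
      {μ : Measure (gl n K).automorphicQuotient} [(gl n K).IsAutomorphicMeasure μ]
      {μ' : Measure (gl m K).automorphicQuotient} [(gl m K).IsAutomorphicMeasure μ'],
      JacquetShalika1981_partialPairL_boundary_of_ne_one (n := n) (m := m) (K := K) (μ := μ)
        (μ' := μ')) :
    ∀ (K : Type) [Field K] [NumberField K], IsTotallyReal K →
      ∀ (hcpt : isCompact_glFiniteIntegralLevel 3 K) (π : CuspidalAutomorphicRepData 3 K hcpt),
        π.1.IsRegularAlgebraic → ∀ μ : HeckeCharacter K, μ.IsAlgebraic →
        (∀ᶠ v : HeightOneSpectrum (𝓞 K) in cofinite, μ.IsUnramifiedAt v ∧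
          ∀ α : Multiset ℂ, π.1.HasSatakeParamAt v α → μ.valueAtUniformizer v ∈ α) →
        ∀ᶠ v : HeightOneSpectrum (𝓞 K) in cofinite,
          ∀ α : Multiset ℂ, π.1.HasSatakeParamAt v α → α.prod = μ.valueAtUniformizer v ^ 3 := by
  intro K _ _ _ hcpt π _ μ _ hμ
  exact prod_satake_eq_cube hJ2 hrk h22' π (hμ.mono fun v hv => hv.2)

/-- **Böckle–Hui, Theorem 1.2, without the contragredient datum.**  What now separates
`isIrreducible_galoisRep_gl3_totallyReal_holds` from the tree:
* named facts, unproved: Böckle–Hui Thm. 1.1 (`exists_heckeCharacter_of_weaklyDivides`), and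
  Jacquet–Shalika (2.2): the Borel–Jacquet form `JacquetShalika1981_partialPairL_boundary_repData` (used
  for the `GL_3 × GL_1` and `GL_1 × GL_1` pairs of Borel–Jacquet data; itself reduced in the tree to
  the four `L²` leaves) and the `L²` leaves `JacquetShalika1981_partialPairL_at_one_of_rank_ne`,
  `…_boundary_of_ne_one` (used for the pairs `π₀^∨ × χ`, realised by `P.conj`);
* printed inputs with no carrier in the tree: C-arithmeticity of `π` (`hCar`, Clozel 3.13 + BG14) and
  [Hu23a] (`hHui`).
[cite: BockleHui2025, Theorem 1.2, §3.1 and §3.2.1] -/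
theorem isIrreducible_galoisRep_gl3_totallyReal_of_JS_L2
    (hBH : GaloisRepresentations.exists_heckeCharacter_of_weaklyDivides)
    (hCar : ∀ {K : Type} [Field K] [NumberField K] (hcpt : isCompact_glFiniteIntegralLevel 3 K),
      IsTotallyReal K → ∀ (π : CuspidalAutomorphicRepData 3 K hcpt), π.1.IsRegularAlgebraic →
      ∃ E : Subfield ℂ, FiniteDimensional ℚ E ∧
        ∀ᶠ v : HeightOneSpectrum (𝓞 K) in cofinite, ∀ α : Multiset ℂ,
          π.1.HasSatakeParamAt v α → ∀ i ≤ 3, heckeEigenvalueOf 3 v α i ∈ E)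
    (hJ2 : JacquetShalika1981_partialPairL_boundary_repData)
    (hrk : ∀ {n m : ℕ} {K : Type} [Field K] [NumberField K]
      {μ : Measure (gl n K).automorphicQuotient} [(gl n K).IsAutomorphicMeasure μ]
      {μ' : Measure (gl m K).automorphicQuotient} [(gl m K).IsAutomorphicMeasure μ'],
      JacquetShalika1981_partialPairL_at_one_of_rank_ne (n := n) (m := m) (K := K) (μ := μ)
        (μ' := μ'))
    (h22' : ∀ {n m : ℕ} {K : Type} [Field K] [NumberField K]
      {μ : Measure (gl n K).automorphicQuotient} [(gl n K).IsAutomorphicMeasure μ]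
      {μ' : Measure (gl m K).automorphicQuotient} [(gl m K).IsAutomorphicMeasure μ'],
      JacquetShalika1981_partialPairL_boundary_of_ne_one (n := n) (m := m) (K := K) (μ := μ)
        (μ' := μ'))
    (hHui : ∀ (K : Type) [Field K] [NumberField K], IsTotallyReal K →
      ∀ (hcpt : isCompact_glFiniteIntegralLevel 3 K) (π : CuspidalAutomorphicRepData 3 K hcpt),
        π.1.IsRegularAlgebraic →
        (∃ η : HeckeCharacter K, ∀ᶠ v : HeightOneSpectrum (𝓞 K) in cofinite,
          ∀ α : Multiset ℂ, π.1.HasSatakeParamAt v α →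
            η.IsUnramifiedAt v ∧ α.map (fun a => a⁻¹) = α.map (fun a => η.valueAtUniformizer v * a)) →
        ∀ (ℓ : ℕ) [Fact ℓ.Prime] (ι : PadicAlgCl ℓ ≃+* ℂ)
        (r : GaloisRepresentations.FramedGaloisRep K (PadicAlgCl ℓ) 3), r.toGaloisRep.IsSemisimple →
        (∀ (v : HeightOneSpectrum (𝓞 K)) (α : Multiset ℂ), π.1.HasSatakeParamAt v α →
            ((ℓ : ℕ) : 𝓞 K) ∉ v.asIdeal →
              r.IsUnramifiedAt v ∧ r.HasFrobCharpolyAt v (arithFrobPolyOfSatake ι v.residueCard 3 α)) →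
        r.toGaloisRep.IsIrreducible) :
    isIrreducible_galoisRep_gl3_totallyReal :=
  isIrreducible_galoisRep_gl3_totallyReal_of_weaklyDivides_of_arithmetic_of_satakeLevel_of_hui hBH
    hCar (satakeLevel_analyticCase_noContragredient hJ2 hrk h22') hHui

/-- **Böckle–Hui, Theorem 1.2, with Jacquet–Shalika (2.2) at its four `L²` leaves and no
contragredient datum**: the remaining named-fact inputs are Böckle–Hui's Thm. 1.1 and the `L²`
facts `JacquetShalika1981_partialPairL_at_one_of_ne_conj`, `…_boundary_of_ne_one`,
`…_at_one_of_rank_ne`, `multiplicity_one_gl` (through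
`JacquetShalika1981_partialPairL_boundary_repData_of_L2_leaves`); the printed inputs `hCar`, `hHui` as
before. [cite: BockleHui2025, Theorem 1.2] [cite: ArthurClozelAMS120, Ch. 3 §2 (2.2)] -/
theorem isIrreducible_galoisRep_gl3_totallyReal_of_L2_leaves'
    (hBH : GaloisRepresentations.exists_heckeCharacter_of_weaklyDivides)
    (hCar : ∀ {K : Type} [Field K] [NumberField K] (hcpt : isCompact_glFiniteIntegralLevel 3 K),
      IsTotallyReal K → ∀ (π : CuspidalAutomorphicRepData 3 K hcpt), π.1.IsRegularAlgebraic →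
      ∃ E : Subfield ℂ, FiniteDimensional ℚ E ∧
        ∀ᶠ v : HeightOneSpectrum (𝓞 K) in cofinite, ∀ α : Multiset ℂ,
          π.1.HasSatakeParamAt v α → ∀ i ≤ 3, heckeEigenvalueOf 3 v α i ∈ E)
    (h22 : ∀ {n : ℕ} {K : Type} [Field K] [NumberField K] {μ : Measure (gl n K).automorphicQuotient}
      [(gl n K).IsAutomorphicMeasure μ],
      JacquetShalika1981_partialPairL_at_one_of_ne_conj (n := n) (K := K) (μ := μ))
    (h22' : ∀ {n m : ℕ} {K : Type} [Field K] [NumberField K]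
      {μ : Measure (gl n K).automorphicQuotient} [(gl n K).IsAutomorphicMeasure μ]
      {μ' : Measure (gl m K).automorphicQuotient} [(gl m K).IsAutomorphicMeasure μ'],
      JacquetShalika1981_partialPairL_boundary_of_ne_one (n := n) (m := m) (K := K) (μ := μ)
        (μ' := μ'))
    (hrk : ∀ {n m : ℕ} {K : Type} [Field K] [NumberField K]
      {μ : Measure (gl n K).automorphicQuotient} [(gl n K).IsAutomorphicMeasure μ]
      {μ' : Measure (gl m K).automorphicQuotient} [(gl m K).IsAutomorphicMeasure μ'],
      JacquetShalika1981_partialPairL_at_one_of_rank_ne (n := n) (m := m) (K := K) (μ := μ)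
        (μ' := μ'))
    (hm1 : ∀ (n : ℕ) (K : Type) [Field K] [NumberField K] (μ : Measure (gl n K).automorphicQuotient)
      [(gl n K).IsAutomorphicMeasure μ], multiplicity_one_gl n K μ)
    (hHui : ∀ (K : Type) [Field K] [NumberField K], IsTotallyReal K →
      ∀ (hcpt : isCompact_glFiniteIntegralLevel 3 K) (π : CuspidalAutomorphicRepData 3 K hcpt),
        π.1.IsRegularAlgebraic →
        (∃ η : HeckeCharacter K, ∀ᶠ v : HeightOneSpectrum (𝓞 K) in cofinite,
          ∀ α : Multiset ℂ, π.1.HasSatakeParamAt v α →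
            η.IsUnramifiedAt v ∧ α.map (fun a => a⁻¹) = α.map (fun a => η.valueAtUniformizer v * a)) →
        ∀ (ℓ : ℕ) [Fact ℓ.Prime] (ι : PadicAlgCl ℓ ≃+* ℂ)
        (r : GaloisRepresentations.FramedGaloisRep K (PadicAlgCl ℓ) 3), r.toGaloisRep.IsSemisimple →
        (∀ (v : HeightOneSpectrum (𝓞 K)) (α : Multiset ℂ), π.1.HasSatakeParamAt v α →
            ((ℓ : ℕ) : 𝓞 K) ∉ v.asIdeal →
              r.IsUnramifiedAt v ∧ r.HasFrobCharpolyAt v (arithFrobPolyOfSatake ι v.residueCard 3 α)) →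
        r.toGaloisRep.IsIrreducible) :
    isIrreducible_galoisRep_gl3_totallyReal :=
  isIrreducible_galoisRep_gl3_totallyReal_of_JS_L2 hBH hCar
    (JacquetShalika1981_partialPairL_boundary_repData_of_L2_leaves h22 h22' hrk hm1) hrk h22' hHui

end Assembly

end Literature.NumberTheory.Automorphic
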